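import Literature.MathematicalPhysics.QuantumFieldTheory.Balaban1983to89.B9Thm313WholeLeafCompletePairMBCZCutU
import Literature.MathematicalPhysics.QuantumFieldTheory.Balaban1983to89.B9Thm313WholeLeafRelZCutUE
import Literature.MathematicalPhysics.QuantumFieldTheory.Balaban1983to89.B9Thm313WholeGGBlocksRegularT
import Literature.MathematicalPhysics.QuantumFieldTheory.Balaban1983to89.B9Thm312WholeSeriesRegular
import Literature.MathematicalPhysics.QuantumFieldTheory.Balaban1983to89.B9StateAprioriL1
import Literature.MathematicalPhysics.QuantumFieldTheory.Balaban1983to89.B9Thm313WholeGXHRegular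
import Literature.MathematicalPhysics.QuantumFieldTheory.Balaban1983to89.B9LettersZSchemasMono

/-!
# `Balaban1983to89.B9Thm313WholeLeafCompletePairMBCZcUSX` — T. Bałaban, *Propagators for lattice gauge theories in a background field*, Commun. Math. Phys. **99** (1985) 389–434
# [`Balaban1985BackgroundPropagators`], Theorem 3.13 p. 426 AS THE WHOLE PRINTED LEAF, PAIR-MBCZc SPECIES, OVER THE REGULAR STATE — `G₁∇*_U` INTO THE BOND HÖLDER CLASS DERIVED
# INSIDE FROM THE STATE: `B9Thm313WholeLeafCompletePairMBCZcUST.thm313Printed_completePairMBCZcUST` (p724752) VERBATIM except that the binder `hletters : … → Letters313Zc …`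
# (whose field `gXH : G₁∇*_U : 𝔠_Y⁽⁰⁾ → bXH` the certificate could only inhabit from a raw-class step, LOCATED-U8″, or from the state at the slower 𝔖₁-step rate, dag-n06-d g19's
# RATE MISMATCH) is REPLACED by the eight bXH-free Z-letters FIELD-WISE (`hZ8`, the certificate's own display) + the (3.44) member `hwGp`, and `gXH` is DERIVED in the proof
# from `hstate1` (`B9Thm313WholeGXHRegular.gXH_of_stateS_two`) under the pin `hSX : 𝔖₁ i U = bXH i U` and the budget `hADB : 2·A_D ≤ B₃`; conclusion `B9.Thm313Printed …` UNCHANGED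

[4] = T. Bałaban, *Propagators and renormalization transformations for lattice gauge theories. II*, Commun. Math. Phys. **96** (1984) 223–250 [`Balaban1984PropagatorsII`].
statement-level skeleton of published theorems with citation tags; proofs where landed; nothing here is a claim about the Yang–Mills mass gap.

THE PRINT.  Thm 3.13 p. 426 (𝔊 satisfies (3.42)–(3.47) by (3.152)–(3.153), Theorem 3.12 and the estimates for G′, R); Thm 3.12 pp. 421–423: the induction behind (3.130)∕(3.138) runs over
functions of Theorem 3.3's type — REGULAR (Hölder sizes of print's species), *"in all norms (3.42)–(3.47)"*; a bare sup class is never the state.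

WHY THIS FILE (cell `pub-ymgap`, node N06, bundle F7 rows 20–21, seat dag-n06-l g29; programme P-U8S″ step (R3) — the ROW-21 S-LEAF of the FLAG №8 (U8) cure of record with
`G₁∇*_U` derived inside).  dag-n06-d g19 RATE MISMATCH (cell INBOX 2026-08-29T15:00Z) on the legged route (this seat's `…N06Letters13LegAtPinsStatePU`, p726471): on the state route
`G₁∇*_U` INTO bXH is DOWNSTREAM of the 𝔖₁ step (rate ≤ δ_K − σ), slower than the common rate δ₃ at which `Letters313Zc` packages the Z-letters — so the field cannot be legged
into the record's (B₃, δ₃) slot.  CURE (R3): the leaf rebuilds `Letters313Zc … B₃ ρ (bXH i U) U` at ITS OWN master rate ρ (ρ ≤ δ₃ is its standing `hρ₃`; every δ₃-rate input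
weakened by `B9LettersZSchemasMono` ∕ `kernel_mono`), with `gXH` := `gXH_of_stateS_two` (StepS on 𝔖₁, the producer G₀∇*_U INTO 𝔖₁, Identities, the ℓ¹-domination, κθc ≤ ½ —
all already in the proof) transported along `hSX` and weakened by `2·A_D ≤ B₃`; `GG_blocks_of_stateST` is called at δ₃ := ρ.  NO leg, NO second constant pair, NO display of `gXH`.
Previous edition's text (p724752): the ROW-21 S-LEAF with the input letters field-wise — director-ym №272 (5) ∕ №289 (1): «U8 cured» = NO raw-class step letter anywhere in the certificate's cone.  LOCATED-U8″ (this seat 2026-08-29,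
dag-n06-d g18 HDR106 independently): p721018's binder `hLIM : Letters313IMBC …` forces the certificate to DISPLAY the record's field `tDv` — the right form
`(Δ′_π+Δ⁽²⁾_π)∘G₀∇_U INTO 𝔠⁽¹⁾` of LOCATED-U8′ §1, T's leading ∇_U un-absorbed on the output side — although the S chain reads only `.rgdd ∕ .dgDvd ∕ .pdgDvd`
(`B9Thm313WholeGGBlocksRegular` tree lines 531∕581∕612∕630).  THIS TWIN takes those three families as hypotheses (member∕α₀-quantified exactly as `hLIM` was), drops the
letter `θV` with `hθV` (it only sized `tDv`; the uniform input constant is now t_V ε = 2A_V ε), and calls `GG_blocks_of_stateST`; every other binder, the proof and the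
conclusion are p721018's.  Companion of the row-20 S-leaf `B9Thm312WholeLeafCompletePairMBZSL` (no input letters there).  HISTORY of the species (p721018's header):  The leaf of record reads the one-step fields `Step.step1 ∕ LeftStep.stepD1 ∕ StepDirB.…1`
on RAW sup classes — the species dag-n06-l LOCATED as beyond print (LOCATED-U8′).  THIS LEAF keeps every letter, reading and geometry binder of `thm313Printed_completePairMBCZcU`
VERBATIM and replaces the raw-state block by: `hmodel` (FormSmall ∧ Identities), `he1` ((3.42)₂ for G₀), `hdomX ∕ hdomW` (the ℓ¹ CONTROL of a `bHX ε` ∕ `bHW ε`-localised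
input, `IsLoc y μ → Σ |μ| ≤ Λ·loc y μ` — LOCATED-S1's binder (R-b), dag-n06-d g18 ∕ director-ym №285: TRUE at the certificate's class-localised pins by
`B9StateAprioriL1.exists_l1_control_bHK ∕ _bHS`, consumed ONLY by `B9StateAprioriL1.exists_hasMaj_const_of_l1_src` for the bootstrap's a-priori constant majorants; the
fibre-localisation transfer `IsLoc → (ofBlocks …).IsLoc` of the `Letters313IMB.locX` shape, refuted at the pins by `B9Letters313IMBLocObstruction.not_isLoc_bHK_imp_ofBlocks`,
is NOT displayed), and the state block `hstate2` (on 𝔖₂: `StepS`; ∇_UG₀T INTO 𝔠_Y⁽¹⁾, ∇_{U,ν}G₀T INTO 𝔠⁽¹⁾, the probes Φ^Y_β∇_UG₀T, Φ^X_β∇_{U,ν}G₀T INTO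
𝔠_P^{(β−1)} — T = Δ′_π + Δ⁽²⁾_π; the producers G₀ (out of 𝔠⁽⁰⁾), G₀D (out of 𝔠_W⁽¹⁾), G₀Q\* (out of Z_w) INTO 𝔖₂; the reading `id : 𝔖₂ → 𝔠^{(−2)}`; ℓ¹-domination) and `hstate1`
(on 𝔖₁: `StepS`; ∇_{U,ν}G₀T INTO 𝔠⁽⁰⁾, Φ^X_βG₀T INTO 𝔠_P^{(β−1)}, Φ^X_β∇_{U,ν}G₀T INTO 𝔠_P^{(β)}; the producers G₀∇\* (out of 𝔠_Y^{(0)}), G₀∇\*_μ (out of `bHX ε`), G₀D (out of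
`bHW ε`), G₀Q\* (out of Z_{len·w}) INTO 𝔖₁; the reading `id : 𝔖₁ → 𝔠^{(−1)}`; ℓ¹-domination), all producers∕readings at one rate δ_P with ρ + 2σ ≤ min(δ_P, δ_K).  PROOF: per member and
configuration, the seven right entries of G₁ INTO the states (`hasMaj_right_of_stepS`, a-priori majorants from the domination data), the fields at the uniform constants,
`B9Thm313WholeGGBlocksRegularT.GG_blocks_of_stateST` (entries, L² block, Hölder∕input block), the expansion pin `B9Thm312WholeSeriesRegular.hasRWExp_of_stepS`, and the frame
`B9Thm313WholeLeafRelZCutUE.thm313Printed_of_entriesRelZcU`.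
HONEST SCOPE.  Re-assembly of landed pieces; every analytic member is a HYPOTHESIS of printed species; nothing of [B9]∕[4] asserted; no pin, no certificate edit; COUNT-NEUTRAL;
N06 NOT discharged; nothing continuum ∕ OS positivity ∕ mass gap ∕ Clay.  Cell `pub-ymgap` (HUMAN RULING D-0062), Track A node N06 [B9], seat `pub-ymgap-dag-n06-l` (g29;
(R3) twin of p724752 ∕ p721018), 2026-08-29.  NEW file; nothing landed is modified (p724752 ∕ p721018 stay for their current callers).
-/

namespace Literature.MathematicalPhysics.QuantumFieldTheory.Balaban1983to89.B9Thm313WholeLeafCompletePairMBCZcUSX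

open Finset B6RandomWalk B6RandomWalkHom B9Thm34Ext B9Thm37GlueCor36 B11SectG B9SectDSup B9Thm37AllNorms
open B9Thm37AllNormsInstances B9FromB6 B9FromB6ModelSignsOn B9SectBStepWhole B9Thm312Whole B9Thm312WholeLeaf B9Thm312WholeLeft B9Thm313Whole
open B9Thm313WholeLeft B9Thm312WholeLeafLeftGlob B9Ineq347CoReading B9SectCDiffDict B9CoRealizesRel B9Thm37Glue B9SectDL2Decay B9RWSums343Holder
open B9RWSumsReadsRel B9RWSumsReadsNbr B9Ineq347 B9Thm312WholeClasses B9Thm312WholeL2 B9Thm312WholeBlocksRel B9Thm312WholeBlocksNbr B9Thm313WholeLeafRel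
open B9Thm312WholeHolder B9Thm312WholeHHolder B9Thm313WholeHolder B9Thm313WholeL2G B9Thm313WholeL2GP B9Thm313WholeInput B9Thm313WholeBlocksNbr B9Thm312WholeLeafAll
open B9RWSums346SecondDiff B9Thm313WholeBlocksNbrRec B9RWSums344InputFam B9Thm312WholeDir B9Thm312WholeBlocksPairM B9Thm313WholeDir B9Thm313WholeDirInput B9Thm313WholeBlocksPairM
open B9Thm313WholeLeafCompletePairM B9Thm312WholeDirB B9Thm313WholeDirInputB B9Thm313WholeBlocksPairMB B9Thm313WholeLeafCompletePairMB B9Thm313WholeBlocksPairMZ B9Thm313WholeBlocksPairMBZ B9Thm313WholeLeafRelZ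
open B9Thm313WholeLeafCompletePairMBZ B9Thm313WholeDirInputBC B9Thm313WholeBlocksPairMBCZ B9Thm313WholeLeafCompletePairMBCZ B9Thm313WholeRgdFrom3152
open B9Thm313WholeLettersCut B9Thm313WholeCutCores B9Thm313WholeLeafRelZCut B9Thm313WholeLeafRelZCutU B9Thm313WholeBlocksPairMZCut B9Thm313WholeBlocksPairMBCZCut
open B9Thm312WholeHZ B9Thm313WholeZ B9Thm313WholeLeftZ B9Thm313WholeHolderZ B9Thm313WholeInputZ B9Thm313WholeDirZ B9Thm313WholeDirInputZ B9Thm313WholeDirInputBZ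
open B9Thm313WholeL2GZ B9Thm313WholeL2GPZ B9Thm313WholeDirL2Z B9Thm313WholeLeafCompletePairMBCZCutU B9Thm313WholeLeafRelZCutUE
open B9Thm312WholeStepRegular B9Thm312WholeSeriesRegular B9Thm313WholeGGBlocksRegular B9Thm313WholeGGBlocksRegularT
open B9Thm313WholeGXHRegular B9LettersZSchemasMono
noncomputable section

section Family

variable {I : Type} {c35 : ℝ} {geo : I → B9.Geometry} {bg : I → B9.Backgrounds}
variable [∀ i, Fintype (geo i).Site] [∀ i, DecidableEq (geo i).Site]
variable {X Y Z W PX PY : I → Type} {P : Type} [∀ i, Fintype (X i)] [∀ i, DecidableEq (X i)] [∀ i, Fintype (Y i)]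
  [∀ i, Fintype (Z i)] [∀ i, Fintype (W i)] [∀ i, Fintype (PX i)] [∀ i, Fintype (PY i)] [Fintype P]

omit [∀ i, Fintype (X i)] [∀ i, DecidableEq (X i)] [∀ i, Fintype (Y i)] [∀ i, Fintype (Z i)] [∀ i, Fintype (W i)]
  [∀ i, Fintype (geo i).Site] [∀ i, DecidableEq (geo i).Site] [∀ i, Fintype (PX i)] [∀ i, Fintype (PY i)] [Fintype P] in
/-- Arithmetic of *"for α₀ sufficiently small"*: t ≧ 0 and m ≦ (2(t + 1))⁻¹ give tm ≦ ½. [folklore] -/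
private theorem small_aux_s {t m : ℝ} (ht : 0 ≤ t) (hm : m ≤ (2 * (t + 1))⁻¹) : t * m ≤ 1 / 2 := by
  have hpos : 0 < 2 * (t + 1) := by linarith
  have h1 : t * m ≤ t * (2 * (t + 1))⁻¹ := mul_le_mul_of_nonneg_left hm ht
  have h2 : t * (2 * (t + 1))⁻¹ ≤ 1 / 2 := by
    rw [← div_eq_mul_inv, div_le_iff₀ hpos]
    linarith
  linarith

set_option maxHeartbeats 1600000 in
/-- ★★★ **THEOREM 3.13 AS PRINTED, PAIR-MBCZc SPECIES, OVER THE REGULAR STATE, Z-LETTERS FIELD-WISE, `G₁∇*_U` INTO bXH DERIVED INSIDE** — see the module docstring: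
`thm313Printed_completePairMBCZcUST` (p724752) with `hletters : Letters313Zc …` replaced by the 8-conjunction `hZ8` + the family `hwGp`, plus the pin `hSX : 𝔖₁ i U = bXH i U`
and the budget `hADB : 2·A_D ≤ B₃` (the derived `gXH`); `hLIM` already the three read families `hrgdd ∕ hdgDvd ∕ hpdgDvd` (no `tDv`, no `θV`); the
letters, readings and geometry binders of `thm313Printed_completePairMBCZcU` otherwise verbatim; the raw-state block replaced by `hmodel` (FormSmall ∧ Identities), `he1`,
`hdomX ∕ hdomW` (ℓ¹ control of localised inputs, (R-b)), `hstate2`, `hstate1`;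
conclusion `B9.Thm313Printed …` UNCHANGED.  Output constants: C_e, C_u β, K₄₄ ε, K₄₅ ε β = the displayed polynomials of `GG_blocks_of_stateST` at the uniform inputs
t_R = 2(A₀+A_W+A_Q+A_D+A_{Q1}), t_D = θ_D a₁, t_H β = θ_H β a₁, t_I ε = 2A_I ε, t_V ε = 2A_V ε, κ_u = max(κ₀, κ_S, 1).
[cite: Balaban1985BackgroundPropagators, Thm 3.13 p.426 + Thm 3.12 pp.421–423 + (3.39)–(3.47) pp.397–398 + (3.126) p.420 + (3.132) p.422 + (3.152)–(3.153) p.426; Balaban1984PropagatorsII, (2.51)–(2.56) pp.232–233 + Lemma 2.1 (2.60)–(2.61) p.234 + (2.66) p.234] -/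
theorem thm313Printed_completePairMBCZcUSX (𝔬 : ∀ i, Ops (geo i) (bg i) (X i) (Y i) (Z i) (W i)) (R₀ : I → ℝ) (H₀ : I → Prop)
    (GG : ∀ i, B9.KernelFamily (geo i) (bg i)) (bH : ∀ i, (bg i).Cfg → BlockNorm (toB6 (geo i) (R₀ i) (H₀ i)) (W i → ℝ))
    (𝔭 : ∀ i, HolderProbes (geo i) (bg i) (X i) (Y i) (PX i) (PY i))
    (bHX : ∀ i, ℝ → BlockNorm (toB6 (geo i) (R₀ i) (H₀ i)) (X i → ℝ))
    (Gp : ∀ i, (bg i).Cfg → Module.End ℝ (W i → ℝ)) (bXH : ∀ i, (bg i).Cfg → BlockNorm (toB6 (geo i) (R₀ i) (H₀ i)) (X i → ℝ))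
    (Dd Dds : ∀ i, (bg i).Cfg → P → Module.End ℝ (X i → ℝ))
    (bHW : ∀ i, (bg i).Cfg → ℝ → BlockNorm (toB6 (geo i) (R₀ i) (H₀ i)) (W i → ℝ))
    (𝔖₂ 𝔖₁ : ∀ i, (bg i).Cfg → BlockNorm (toB6 (geo i) (R₀ i) (H₀ i)) (X i → ℝ))
    (ev : ∀ i, (geo i).Loc → X i → ℝ) (evY : ∀ i, (geo i).Loc → Y i → ℝ) {PL : ∀ i, (geo i).Loc → Prop}
    (Rel : ∀ i, (geo i).Site → (geo i).Site → Prop) [∀ i, DecidableRel (Rel i)] (m mN : ℕ)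
    (r Cev CL θS θD θ₂ r₁ B₀ B₂ B₄ δ₀ δK δP σ c ρ a₁ M₁ ML B₃ δ₃ ρ' α Lc κ₀ κS A₀ AW AQ AD AQ1 CR CR₁ : ℝ)
    (Bh Bi Bq BhD Bx Bd θH Br AI AV : ℝ → ℝ) (Bi2 Bd2 : ℝ → ℝ → ℝ)
    (hθS : 0 ≤ θS) (hθD : 0 ≤ θD) (hθH : ∀ β, 0 ≤ β → β < 1 → 0 ≤ θH β) (hθ₂ : 0 ≤ θ₂)
    (hκS : 1 ≤ κS) (hA₀ : 0 ≤ A₀) (hAW : 0 ≤ AW) (hAQ : 0 ≤ AQ) (hAD : 0 ≤ AD) (hAQ1 : 0 ≤ AQ1) (hCR : 0 ≤ CR) (hCR₁ : 0 ≤ CR₁)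
    (hAI : ∀ ε, 0 < ε → 0 ≤ AI ε) (hAV : ∀ ε, 0 < ε → 0 ≤ AV ε)
    (hr₁ : 0 ≤ r₁) (hB₀ : 0 ≤ B₀) (hB₂ : 0 ≤ B₂)
    (hB₃ : 0 ≤ B₃) (hB₄ : 0 ≤ B₄) (hBr : ∀ ε, 0 < ε → 0 ≤ Br ε) (hσ : 0 ≤ σ) (hρ' : 0 < ρ') (hρ'ρ : ρ' + 3 * σ ≤ ρ) (hρ'ρ₅ : ρ' + 5 * σ ≤ ρ)
    (hσρ' : 3 * σ < (1 - α) * ρ')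
    (hρS : ρ ≤ δ₀) (hρ₃ : ρ ≤ δ₃) (hρδ : ρ + 2 * σ ≤ δK) (hρP : ρ + 2 * σ ≤ δP) (hc : 0 ≤ c) (ha₁ : 0 < a₁) (hM₁ : 0 < M₁)
    (hα0 : 0 ≤ α) (hBi : ∀ ε, 0 < ε → ε ≤ 1 → 0 ≤ Bi ε) (hBd : ∀ ε, 0 < ε → ε ≤ 1 → 0 ≤ Bd ε)
    (hBi2 : ∀ ε β, 0 < ε → ε ≤ 1 → 0 ≤ β → β < 1 → 0 ≤ Bi2 ε β) (hBd2 : ∀ ε β, 0 < ε → ε ≤ 1 → 0 ≤ β → β < 1 → 0 ≤ Bd2 ε β)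
    (hBh : ∀ β, 0 ≤ β → β < 1 → 0 ≤ Bh β) (hBq : ∀ β, 0 ≤ β → β < 1 → 0 ≤ Bq β) (hBhD : ∀ β, 0 ≤ β → β < 1 → 0 ≤ BhD β)
    (hBx : ∀ β, 0 ≤ β → β < 1 → 0 ≤ Bx β) (hCev : 0 ≤ Cev) (hCL1 : 1 ≤ CL)
    (hgeo : ∀ i, GeoOK (geo i)) (S : ∀ i, ModelSignsOn (geo i) (PL i))
    (hL1 : ∀ i, 1 ≤ (geo i).L) (hLle : ∀ i, (geo i).L ≤ Lc) (hη : ∀ i, 0 < (geo i).eta) (hκ : ∀ (i : I) (U : (bg i).Cfg), (bH i U).κ ≤ κ₀)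
    (hκW : ∀ (i : I) (U : (bg i).Cfg) (ε : ℝ), (bHW i U ε).κ ≤ κ₀) (hκX : ∀ (i : I) (U : (bg i).Cfg), (bXH i U).κ ≤ κ₀)
    (hκ2 : ∀ (i : I) (U : (bg i).Cfg), (𝔖₂ i U).κ ≤ κS) (hκ1 : ∀ (i : I) (U : (bg i).Cfg), (𝔖₁ i U).κ ≤ κS)
    -- 𝔖₁ IS the bond Hölder class bXH (the pin; `rfl` at the certificate) and the budget of the DERIVED G₁∇\*_U INTO bXH (constant 2·A_D)
    (hSX : ∀ (i : I) (U : (bg i).Cfg), 𝔖₁ i U = bXH i U) (hADB : 2 * AD ≤ B₃)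
    (hrow : ∀ i, ML ≤ (geo i).M → RowSum (toB6 (geo i) (R₀ i) (H₀ i)) σ c)
    (hL21 : ∀ δ : ℝ, 0 < δ → ∃ ML' c' : ℝ, Lemma21AboveG geo R₀ H₀ δ α ML' c')
    (hnbr : ∀ (i : I) (y : (geo i).Site), (nbr (geo i) r y).card ≤ mN)
    (hCL : ∀ (i : I) (a a' : (geo i).Site), (geo i).dist a a' ≤ r → (geo i).len a ≤ CL * (geo i).len a')
    (hsat : ∀ (i : I) (n : Fin 4) (B' δ' : ℝ),
      (∀ a a' b, Rel i a a' → maj342 (geo i) n B' δ' a b = maj342 (geo i) n B' δ' a' b) ∧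
      (∀ a b b', Rel i b b' → maj342 (geo i) n B' δ' a b = maj342 (geo i) n B' δ' a b'))
    (hmult : ∀ (i : I) (y' : (geo i).Site), (Finset.univ.filter (fun y'' => Rel i y'' y')).card ≤ m)
    (hcoR : ∀ (i : I) (U : (bg i).Cfg),
      CoRealizesRel (GG i) 0 U (Rel i) (𝔬 i).blk (𝔬 i).blk (ev i) ((𝔬 i).GG U) ∧
      CoRealizesRel (GG i) 2 U (Rel i) (𝔬 i).blk (𝔬 i).blkY (evY i) ((𝔬 i).GG U ∘ₗ (𝔬 i).Dstar U))
    (hco1R : ∀ (i : I) (U : (bg i).Cfg), CoRealizesRel (GG i) 1 U (Rel i) (𝔬 i).blkY (𝔬 i).blk (ev i) ((𝔬 i).D U ∘ₗ (𝔬 i).GG U))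
    (hcoG : ∀ (i : I) (U : (bg i).Cfg),
      CoReadsGlob (GG i) 0 U (𝔬 i).blk (𝔬 i).blk (ev i) ((𝔬 i).GG U) ∧
      CoReadsGlob (GG i) 1 U (𝔬 i).blkY (𝔬 i).blk (ev i) ((𝔬 i).D U ∘ₗ (𝔬 i).GG U) ∧
      CoReadsGlob (GG i) 2 U (𝔬 i).blk (𝔬 i).blkY (evY i) ((𝔬 i).GG U ∘ₗ (𝔬 i).Dstar U))
    (hsymGG : ∀ i, M₁ ≤ (geo i).M → ∀ α₀ : ℝ, 0 < α₀ → (geo i).M * α₀ ≤ a₁ →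
      ∀ U : (bg i).Cfg, (bg i).Reg335 c35 α₀ U → (bg i).Reg336 c35 α₀ U →
        IsTransposePair ((𝔬 i).GG U) ((𝔬 i).GG U) ∧ IsTransposePair ((𝔬 i).D U ∘ₗ (𝔬 i).GG U) ((𝔬 i).GG U ∘ₗ (𝔬 i).Dstar U))
    (hl2N : ∀ (i : I) (U : (bg i).Cfg),
      L2ReadsNbr (R := R₀ i) (H := H₀ i) (GG i) 0 U (Rel i) r Cev (𝔬 i).blk (𝔬 i).blk (ev i) ((𝔬 i).GG U) ∧
      L2ReadsNbr (R := R₀ i) (H := H₀ i) (GG i) 1 U (Rel i) r Cev (𝔬 i).blkY (𝔬 i).blk (ev i) ((𝔬 i).D U ∘ₗ (𝔬 i).GG U) ∧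
      L2ReadsNbr (R := R₀ i) (H := H₀ i) (GG i) 2 U (Rel i) r Cev (𝔬 i).blk (𝔬 i).blkY (evY i) ((𝔬 i).GG U ∘ₗ (𝔬 i).Dstar U) ∧
      L2ReadsNbr (R := R₀ i) (H := H₀ i) (GG i) 3 U (Rel i) r Cev ((𝔬 i).blk ∘ Prod.fst) (𝔬 i).blk (ev i)
        (familyOp (fun q : P × P => Dd i U q.1 ∘ₗ ((𝔬 i).GG U ∘ₗ Dds i U q.2))) ∧
      L2ReadsNbr (R := R₀ i) (H := H₀ i) (GG i) 4 U (Rel i) r Cev ((𝔬 i).blk ∘ Prod.fst) (𝔬 i).blk (ev i)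
        (familyOp (fun q : P × P => (Dd i U q.1 ∘ₗ Dd i U q.2) ∘ₗ (𝔬 i).GG U)) ∧
      L2ReadsNbr (R := R₀ i) (H := H₀ i) (GG i) 5 U (Rel i) r Cev ((𝔬 i).blk ∘ Prod.fst) (𝔬 i).blk (ev i)
        (familyOp (fun q : P × P => (𝔬 i).GG U ∘ₗ (Dds i U q.1 ∘ₗ Dds i U q.2))))
    (hH1N : ∀ (i : I) (U : (bg i).Cfg),
      H1ReadsNbr (GG i) U (𝔭 i) (Rel i) r (𝔬 i).blk (𝔬 i).blkY (ev i) (evY i) ((𝔬 i).D U ∘ₗ (𝔬 i).GG U)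
        ((𝔬 i).GG U ∘ₗ (𝔬 i).Dstar U))
    (hIF : ∀ (i : I) (U : (bg i).Cfg),
      InputReadsFam (GG i) U (bHX i) r ((𝔬 i).blk ∘ Prod.fst) ((𝔭 i).blkPX ∘ Prod.fst) (fun β => sliceProbe ((𝔭 i).ΦX U β)) (ev i)
        (familyOp (fun q : P × P => Dd i U q.1 ∘ₗ ((𝔬 i).GG U ∘ₗ Dds i U q.2))))
    (hRdist : ∀ (i : I) (a a' b : (geo i).Site), Rel i a a' → (geo i).dist a b = (geo i).dist a' b)
    (hmodel : ∀ i, M₁ ≤ (geo i).M → ∀ α₀ : ℝ, 0 < α₀ → (geo i).M * α₀ ≤ a₁ →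
      ∀ U : (bg i).Cfg, (bg i).Reg335 c35 α₀ U → (bg i).Reg336 c35 α₀ U →
        FormSmall (𝔬 i) (r₁ * ((geo i).M * α₀)) U ∧ Identities (𝔬 i) U)
    (he1 : ∀ i, M₁ ≤ (geo i).M → ∀ α₀ : ℝ, 0 < α₀ → (geo i).M * α₀ ≤ a₁ →
      ∀ U : (bg i).Cfg, (bg i).Reg335 c35 α₀ U → (bg i).Reg336 c35 α₀ U →
        HasMajorantHom (g := toB6 (geo i) (R₀ i) (H₀ i)) (𝔬 i).blk (𝔬 i).blkY ((𝔬 i).D U ∘ₗ (𝔬 i).G0 U)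
          (fun (a b : (geo i).Site) => B₀ * (geo i).len a * Real.exp (-(δ₀ * (geo i).dist a b))))
    (wZ : ∀ i, (geo i).Site → ℝ) (hwZ : ∀ i y, 0 < wZ i y)
    -- the EIGHT bXH-free letters of Theorem 3.13's reduction FIELD-WISE (the certificate's display `hZ8` verbatim: gD2 gQs2 gQs1 rgd2 c1_2 c1_1 q2 q1 at B₃ δ₃)
    (hZ8 : ∀ i, M₁ ≤ (geo i).M → ∀ α₀ : ℝ, 0 < α₀ → (geo i).M * α₀ ≤ a₁ →
      ∀ U : (bg i).Cfg, (bg i).Reg335 c35 α₀ U → (bg i).Reg336 c35 α₀ U →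
        HasMaj (cNorm (R₀ i) (H₀ i) (𝔬 i).blkW (hgeo i).lenle 1) (cNorm (R₀ i) (H₀ i) (𝔬 i).blk (hgeo i).lenle 2) ((𝔬 i).G0 U ∘ₗ (𝔬 i).Dv U) (fun a b => B₃ * Real.exp (-(δ₃ * (geo i).dist a b))) ∧
        HasMaj (weightNorm (BlockNorm.ofBlocks (toB6 (geo i) (R₀ i) (H₀ i)) (𝔬 i).blkZ) (wZ i) fun y => (hwZ i y).le) (cNorm (R₀ i) (H₀ i) (𝔬 i).blk (hgeo i).lenle 2) ((𝔬 i).G0 U ∘ₗ (𝔬 i).Qstar U) (fun a b => B₃ * Real.exp (-(δ₃ * (geo i).dist a b))) ∧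
        HasMaj (weightNorm (BlockNorm.ofBlocks (toB6 (geo i) (R₀ i) (H₀ i)) (𝔬 i).blkZ) (fun y => (geo i).len y * wZ i y) fun y => (wZlen_pos (hgeo i) (hwZ i) y).le) (cNorm (R₀ i) (H₀ i) (𝔬 i).blk (hgeo i).lenle 1) ((𝔬 i).G0 U ∘ₗ (𝔬 i).Qstar U) (fun a b => B₃ * Real.exp (-(δ₃ * (geo i).dist a b))) ∧
        HasMaj (cNorm (R₀ i) (H₀ i) (𝔬 i).blk (hgeo i).lenle 0) (cNorm (R₀ i) (H₀ i) (𝔬 i).blkW (hgeo i).lenle 1) ((𝔬 i).R U ∘ₗ (𝔬 i).Dvstar U ∘ₗ (𝔬 i).G1 U ∘ₗ LinearMap.id) (fun a b => B₃ * Real.exp (-(δ₃ * (geo i).dist a b))) ∧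
        HasMaj (cNorm (R₀ i) (H₀ i) (𝔬 i).blkZ (hgeo i).lenle 2) (weightNorm (BlockNorm.ofBlocks (toB6 (geo i) (R₀ i) (H₀ i)) (𝔬 i).blkZ) (wZ i) fun y => (hwZ i y).le) ((𝔬 i).C1 U) (fun a b => B₃ * Real.exp (-(δ₃ * (geo i).dist a b))) ∧
        HasMaj (cNorm (R₀ i) (H₀ i) (𝔬 i).blkZ (hgeo i).lenle 1) (weightNorm (BlockNorm.ofBlocks (toB6 (geo i) (R₀ i) (H₀ i)) (𝔬 i).blkZ) (fun y => (geo i).len y * wZ i y) fun y => (wZlen_pos (hgeo i) (hwZ i) y).le) ((𝔬 i).C1 U) (fun a b => B₃ * Real.exp (-(δ₃ * (geo i).dist a b))) ∧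
        HasMaj (cNorm (R₀ i) (H₀ i) (𝔬 i).blk (hgeo i).lenle 2) (cNorm (R₀ i) (H₀ i) (𝔬 i).blkZ (hgeo i).lenle 2) ((𝔬 i).Q U) (fun a b => B₃ * Real.exp (-(δ₃ * (geo i).dist a b))) ∧
        HasMaj (cNorm (R₀ i) (H₀ i) (𝔬 i).blk (hgeo i).lenle 1) (cNorm (R₀ i) (H₀ i) (𝔬 i).blkZ (hgeo i).lenle 1) ((𝔬 i).Q U) (fun a b => B₃ * Real.exp (-(δ₃ * (geo i).dist a b))))
    -- the (3.44) member of ∇_UG′R∇\*_U out of bXH (the certificate's derived `wGp`)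
    (hwGp : ∀ i, M₁ ≤ (geo i).M → ∀ α₀ : ℝ, 0 < α₀ → (geo i).M * α₀ ≤ a₁ →
      ∀ U : (bg i).Cfg, (bg i).Reg335 c35 α₀ U → (bg i).Reg336 c35 α₀ U →
        HasMaj (bXH i U) (cNorm (R₀ i) (H₀ i) (𝔬 i).blk (hgeo i).lenle 1) ((𝔬 i).Dv U ∘ₗ Gp i U ∘ₗ (𝔬 i).R U ∘ₗ (𝔬 i).Dvstar U) (fun a b => B₃ * Real.exp (-(δ₃ * (geo i).dist a b))))
    (h152 : ∀ i, M₁ ≤ (geo i).M → ∀ α₀ : ℝ, 0 < α₀ → (geo i).M * α₀ ≤ a₁ →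
      ∀ U : (bg i).Cfg, (bg i).Reg335 c35 α₀ U → (bg i).Reg336 c35 α₀ U → Ids3152 (𝔬 i) (Gp i) U)
    (hlettersD : ∀ i, M₁ ≤ (geo i).M → ∀ α₀ : ℝ, 0 < α₀ → (geo i).M * α₀ ≤ a₁ →
      ∀ U : (bg i).Cfg, (bg i).Reg335 c35 α₀ U → (bg i).Reg336 c35 α₀ U →
        Letters313DZ (𝔬 i) (R₀ i) (H₀ i) (hgeo i) (wZ i) (hwZ i) B₃ δ₃ (bH i U) U ∧
          Letters313DMZ (𝔬 i) (𝔭 i) (Dd i) (R₀ i) (H₀ i) (hgeo i) (wZ i) (hwZ i) B₃ Bq δ₃ (bH i U) U)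
    (hG0C : ∀ i, M₁ ≤ (geo i).M → ∀ α₀ : ℝ, 0 < α₀ → (geo i).M * α₀ ≤ a₁ →
      ∀ U : (bg i).Cfg, (bg i).Reg335 c35 α₀ U → (bg i).Reg336 c35 α₀ U →
        Thm33G0Dir (𝔬 i) (𝔭 i) (Dd i) (Dds i) (R₀ i) (H₀ i) (bHX i) B₀ Bh Bi Bi2 δ₀ U ∧
          Thm33G0DirR (𝔬 i) (Dds i) (R₀ i) (H₀ i) B₀ δ₀ U)
    (hLHH : ∀ i, M₁ ≤ (geo i).M → ∀ α₀ : ℝ, 0 < α₀ → (geo i).M * α₀ ≤ a₁ →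
      ∀ U : (bg i).Cfg, (bg i).Reg335 c35 α₀ U → (bg i).Reg336 c35 α₀ U →
        LettersHHZ (𝔬 i) (𝔭 i) (R₀ i) (H₀ i) (hgeo i).lenle
          (weightNorm (BlockNorm.ofBlocks (toB6 (geo i) (R₀ i) (H₀ i)) (𝔬 i).blkZ) (wZ i) fun y => (hwZ i y).le) Bq δ₃ U)
    (hLH3 : ∀ i, M₁ ≤ (geo i).M → ∀ α₀ : ℝ, 0 < α₀ → (geo i).M * α₀ ≤ a₁ →
      ∀ U : (bg i).Cfg, (bg i).Reg335 c35 α₀ U → (bg i).Reg336 c35 α₀ U →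
        Letters313HZc (𝔬 i) (𝔭 i) (Gp i) (R₀ i) (H₀ i) (hgeo i) (wZ i) (hwZ i) (bH i U) BhD Bx δ₃ (bXH i U) U)
    (hG0L2 : ∀ i, M₁ ≤ (geo i).M → ∀ α₀ : ℝ, 0 < α₀ → (geo i).M * α₀ ≤ a₁ →
      ∀ U : (bg i).Cfg, (bg i).Reg335 c35 α₀ U → (bg i).Reg336 c35 α₀ U →
        Thm33G0L2M (𝔬 i) (Dd i) (Dds i) (R₀ i) (H₀ i) B₂ δ₀ U)
    (hstepL2 : ∀ i, M₁ ≤ (geo i).M → ∀ α₀ : ℝ, 0 < α₀ → (geo i).M * α₀ ≤ a₁ →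
      ∀ U : (bg i).Cfg, (bg i).Reg335 c35 α₀ U → (bg i).Reg336 c35 α₀ U →
        StepL2 (𝔬 i) (R₀ i) (H₀ i) (θ₂ * ((geo i).M * α₀)) δK U)
    (vZ : ∀ i, (geo i).Site → ℝ) (hvZ : ∀ i y, 0 < vZ i y)
    (hLL2 : ∀ i, M₁ ≤ (geo i).M → ∀ α₀ : ℝ, 0 < α₀ → (geo i).M * α₀ ≤ a₁ →
      ∀ U : (bg i).Cfg, (bg i).Reg335 c35 α₀ U → (bg i).Reg336 c35 α₀ U →
        Letters313L2Pc (𝔬 i) (Dd i) (Dds i) (R₀ i) (H₀ i) B₄ δ₃ (vZ i) (hvZ i) U ∧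
          Letters313L2MZ (𝔬 i) (Dd i) (Dds i) (R₀ i) (H₀ i) B₄ δ₃ (vZ i) (hvZ i) U)
    (hrgdd : ∀ i, M₁ ≤ (geo i).M → ∀ α₀ : ℝ, 0 < α₀ → (geo i).M * α₀ ≤ a₁ →
      ∀ U : (bg i).Cfg, (bg i).Reg335 c35 α₀ U → (bg i).Reg336 c35 α₀ U →
        ∀ (μ : P) (ε : ℝ), 0 < ε → HasMaj (bHX i ε) (bHW i U ε) ((𝔬 i).R U ∘ₗ (𝔬 i).Dvstar U ∘ₗ (𝔬 i).G1 U ∘ₗ Dds i U μ)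
          (fun a b => Br ε * Real.exp (-(δ₃ * (geo i).dist a b))))
    (hdgDvd : ∀ i, M₁ ≤ (geo i).M → ∀ α₀ : ℝ, 0 < α₀ → (geo i).M * α₀ ≤ a₁ →
      ∀ U : (bg i).Cfg, (bg i).Reg335 c35 α₀ U → (bg i).Reg336 c35 α₀ U →
        ∀ (ν : P) (ε : ℝ), 0 < ε → ε ≤ 1 → HasMaj (bHW i U ε) (BlockNorm.ofBlocks (toB6 (geo i) (R₀ i) (H₀ i)) (𝔬 i).blk)
          (Dd i U ν ∘ₗ ((𝔬 i).G0 U ∘ₗ (𝔬 i).Dv U)) (fun (a b : (geo i).Site) => Bd ε * Real.exp (-(δ₃ * (geo i).dist a b))))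
    (hpdgDvd : ∀ i, M₁ ≤ (geo i).M → ∀ α₀ : ℝ, 0 < α₀ → (geo i).M * α₀ ≤ a₁ →
      ∀ U : (bg i).Cfg, (bg i).Reg335 c35 α₀ U → (bg i).Reg336 c35 α₀ U →
        ∀ (ν : P) (ε β : ℝ), 0 < ε → ε ≤ 1 → 0 ≤ β → β < 1 →
          HasMaj (bHW i U (β + ε)) (BlockNorm.ofBlocks (toB6 (geo i) (R₀ i) (H₀ i)) (𝔭 i).blkPX)
            (((𝔭 i).ΦX U β ∘ₗ Dd i U ν) ∘ₗ ((𝔬 i).G0 U ∘ₗ (𝔬 i).Dv U))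
            (fun (a b : (geo i).Site) => Bd2 ε β * (geo i).len a ^ (-β) * Real.exp (-(δ₃ * (geo i).dist a b))))
    (hdomX : ∀ (i : I) (ε : ℝ), 0 < ε → ∃ ΛX : ℝ, 0 ≤ ΛX ∧
      ∀ (y : (geo i).Site) (μ : X i → ℝ), (bHX i ε).IsLoc y μ → ∑ q : X i, |μ q| ≤ ΛX * (bHX i ε).loc y μ)
    (hdomW : ∀ (i : I) (U : (bg i).Cfg) (ε : ℝ), 0 < ε → ∃ ΛW : ℝ, 0 ≤ ΛW ∧
      ∀ (y : (geo i).Site) (μ : W i → ℝ), (bHW i U ε).IsLoc y μ → ∑ w : W i, |μ w| ≤ ΛW * (bHW i U ε).loc y μ)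
    (hstate2 : ∀ i, M₁ ≤ (geo i).M → ∀ α₀ : ℝ, 0 < α₀ → (geo i).M * α₀ ≤ a₁ →
      ∀ U : (bg i).Cfg, (bg i).Reg335 c35 α₀ U → (bg i).Reg336 c35 α₀ U →
        StepS (𝔬 i) (𝔖₂ i U) (θS * ((geo i).M * α₀)) δK U ∧
        HasMaj (𝔖₂ i U) (cNorm (R₀ i) (H₀ i) (𝔬 i).blkY (hgeo i).lenle 1) ((𝔬 i).D U ∘ₗ (𝔬 i).G0 U ∘ₗ ((𝔬 i).Tpi U + (𝔬 i).T2 U))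
          (fun a b => θD * ((geo i).M * α₀) * Real.exp (-(δK * (geo i).dist a b))) ∧
        (∀ ν : P, HasMaj (𝔖₂ i U) (cNorm (R₀ i) (H₀ i) (𝔬 i).blk (hgeo i).lenle 1) (Dd i U ν ∘ₗ (𝔬 i).G0 U ∘ₗ ((𝔬 i).Tpi U + (𝔬 i).T2 U))
          (fun a b => θD * ((geo i).M * α₀) * Real.exp (-(δK * (geo i).dist a b)))) ∧
        (∀ β : ℝ, 0 ≤ β → β < 1 → HasMaj (𝔖₂ i U) (cNormR (R₀ i) (H₀ i) (𝔭 i).blkPY (hgeo i).lenle (β - 1))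
          (((𝔭 i).ΦY U β ∘ₗ (𝔬 i).D U ∘ₗ (𝔬 i).G0 U) ∘ₗ ((𝔬 i).Tpi U + (𝔬 i).T2 U))
          (fun a b => θH β * ((geo i).M * α₀) * Real.exp (-(δK * (geo i).dist a b)))) ∧
        (∀ (ν : P) (β : ℝ), 0 ≤ β → β < 1 → HasMaj (𝔖₂ i U) (cNormR (R₀ i) (H₀ i) (𝔭 i).blkPX (hgeo i).lenle (β - 1))
          (((𝔭 i).ΦX U β ∘ₗ Dd i U ν ∘ₗ (𝔬 i).G0 U) ∘ₗ ((𝔬 i).Tpi U + (𝔬 i).T2 U))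
          (fun a b => θH β * ((geo i).M * α₀) * Real.exp (-(δK * (geo i).dist a b)))) ∧
        HasMaj (cNorm (R₀ i) (H₀ i) (𝔬 i).blk (hgeo i).lenle 0) (𝔖₂ i U) ((𝔬 i).G0 U)
          (fun a b => A₀ * Real.exp (-(δP * (geo i).dist a b))) ∧
        HasMaj (cNorm (R₀ i) (H₀ i) (𝔬 i).blkW (hgeo i).lenle 1) (𝔖₂ i U) ((𝔬 i).G0 U ∘ₗ (𝔬 i).Dv U)
          (fun a b => AW * Real.exp (-(δP * (geo i).dist a b))) ∧
        HasMaj (weightNorm (BlockNorm.ofBlocks (toB6 (geo i) (R₀ i) (H₀ i)) (𝔬 i).blkZ) (wZ i) fun y => (hwZ i y).le) (𝔖₂ i U)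
          ((𝔬 i).G0 U ∘ₗ (𝔬 i).Qstar U) (fun a b => AQ * Real.exp (-(δP * (geo i).dist a b))) ∧
        HasMaj (𝔖₂ i U) (cNormR (R₀ i) (H₀ i) (𝔬 i).blk (hgeo i).lenle (-2)) LinearMap.id
          (fun a b => CR * Real.exp (-(δP * (geo i).dist a b))) ∧
        (∃ Λ : ℝ, 0 ≤ Λ ∧ ∀ (y : (geo i).Site) (F : X i → ℝ), (𝔖₂ i U).loc y F ≤ Λ * ∑ x : X i, |F x|))
    (hstate1 : ∀ i, M₁ ≤ (geo i).M → ∀ α₀ : ℝ, 0 < α₀ → (geo i).M * α₀ ≤ a₁ →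
      ∀ U : (bg i).Cfg, (bg i).Reg335 c35 α₀ U → (bg i).Reg336 c35 α₀ U →
        StepS (𝔬 i) (𝔖₁ i U) (θS * ((geo i).M * α₀)) δK U ∧
        (∀ ν : P, HasMaj (𝔖₁ i U) (cNormR (R₀ i) (H₀ i) (𝔬 i).blk (hgeo i).lenle 0) (Dd i U ν ∘ₗ (𝔬 i).G0 U ∘ₗ ((𝔬 i).Tpi U + (𝔬 i).T2 U))
          (fun a b => θD * ((geo i).M * α₀) * Real.exp (-(δK * (geo i).dist a b)))) ∧
        (∀ β : ℝ, 0 ≤ β → β < 1 → HasMaj (𝔖₁ i U) (cNormR (R₀ i) (H₀ i) (𝔭 i).blkPX (hgeo i).lenle (β - 1))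
          (((𝔭 i).ΦX U β ∘ₗ (𝔬 i).G0 U) ∘ₗ ((𝔬 i).Tpi U + (𝔬 i).T2 U))
          (fun a b => θH β * ((geo i).M * α₀) * Real.exp (-(δK * (geo i).dist a b)))) ∧
        (∀ (ν : P) (β : ℝ), 0 ≤ β → β < 1 → HasMaj (𝔖₁ i U) (cNormR (R₀ i) (H₀ i) (𝔭 i).blkPX (hgeo i).lenle β)
          (((𝔭 i).ΦX U β ∘ₗ Dd i U ν ∘ₗ (𝔬 i).G0 U) ∘ₗ ((𝔬 i).Tpi U + (𝔬 i).T2 U))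
          (fun a b => θH β * ((geo i).M * α₀) * Real.exp (-(δK * (geo i).dist a b)))) ∧
        HasMaj (cNormR (R₀ i) (H₀ i) (𝔬 i).blkY (hgeo i).lenle 0) (𝔖₁ i U) ((𝔬 i).G0 U ∘ₗ (𝔬 i).Dstar U)
          (fun a b => AD * Real.exp (-(δP * (geo i).dist a b))) ∧
        (∀ (μ : P) (ε : ℝ), 0 < ε → HasMaj (bHX i ε) (𝔖₁ i U) ((𝔬 i).G0 U ∘ₗ Dds i U μ)
          (fun a b => AI ε * Real.exp (-(δP * (geo i).dist a b)))) ∧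
        (∀ ε : ℝ, 0 < ε → HasMaj (bHW i U ε) (𝔖₁ i U) ((𝔬 i).G0 U ∘ₗ (𝔬 i).Dv U)
          (fun a b => AV ε * Real.exp (-(δP * (geo i).dist a b)))) ∧
        HasMaj (weightNorm (BlockNorm.ofBlocks (toB6 (geo i) (R₀ i) (H₀ i)) (𝔬 i).blkZ) (fun y => (geo i).len y * wZ i y)
            fun y => (wZlen_pos (hgeo i) (hwZ i) y).le) (𝔖₁ i U)
          ((𝔬 i).G0 U ∘ₗ (𝔬 i).Qstar U) (fun a b => AQ1 * Real.exp (-(δP * (geo i).dist a b))) ∧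
        HasMaj (𝔖₁ i U) (cNormR (R₀ i) (H₀ i) (𝔬 i).blk (hgeo i).lenle (-1)) LinearMap.id
          (fun a b => CR₁ * Real.exp (-(δP * (geo i).dist a b))) ∧
        (∃ Λ : ℝ, 0 ≤ Λ ∧ ∀ (y : (geo i).Site) (F : X i → ℝ), (𝔖₁ i U).loc y F ≤ Λ * ∑ x : X i, |F x|)) :
    B9.Thm313Printed c35 geo bg GG (fun i => HasRWExpOfOps (𝔬 i)) (fun i => PosDefKOfOps (𝔬 i)) := by  -- thresholds and uniform constants
  obtain ⟨MLg, cg, hLg⟩ := hL21 ρ' hρ'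
  set M₁' : ℝ := max (max M₁ ML) MLg with hM₁'
  have hM₁'pos : 0 < M₁' := lt_max_of_lt_left (lt_max_of_lt_left hM₁)
  have hle₁ : ∀ {i : I}, M₁' ≤ (geo i).M → M₁ ≤ (geo i).M := fun h => ((le_max_left _ _).trans (le_max_left _ _)).trans h
  have hleL : ∀ {i : I}, M₁' ≤ (geo i).M → ML ≤ (geo i).M := fun h => ((le_max_right _ _).trans (le_max_left _ _)).trans h
  have hleg : ∀ {i : I}, M₁' ≤ (geo i).M → MLg ≤ (geo i).M := fun h => (le_max_right _ _).trans h
  set κu : ℝ := max (max κ₀ κS) 1 with hκu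
  have h1κ : (1 : ℝ) ≤ κu := le_max_right _ _
  have hκu0 : 0 ≤ κu := zero_le_one.trans h1κ
  have hκSu : κS ≤ κu := (le_max_right _ _).trans (le_max_left _ _)
  have hκ0u : κ₀ ≤ κu := (le_max_left _ _).trans (le_max_left _ _)
  have hκθc : 0 ≤ κu * θS * c := mul_nonneg (mul_nonneg hκu0 hθS) hc
  have hB₂c : 0 ≤ B₂ * θ₂ * c * c := mul_nonneg (mul_nonneg (mul_nonneg hB₂ hθ₂) hc) hc
  set a₁' : ℝ := min a₁ (min (2 * (κu * θS * c + 1))⁻¹ (2 * (B₂ * θ₂ * c * c + 1))⁻¹) with ha₁'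
  have ha₁'pos : 0 < a₁' := lt_min ha₁ (lt_min (inv_pos.mpr (by linarith)) (inv_pos.mpr (by linarith)))
  have ha₁'le : a₁' ≤ a₁ := min_le_left _ _
  have hLc1 : ∀ i, 1 ≤ Lc := fun i => (hL1 i).trans (hLle i)
  set Λu : ℝ := Lc ^ (4 : ℝ) with hΛu
  set NP : ℝ := Real.sqrt (Fintype.card (P × P)) with hNP
  have hNP0 : 0 ≤ NP := Real.sqrt_nonneg _
  -- the uniform member constants: right entries tR, tI, tV; fields tD, tH
  set Amax : ℝ := A₀ + AW + AQ + AD + AQ1 with hAmax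
  have hAmax0 : 0 ≤ Amax := by rw [hAmax]; positivity
  set tR : ℝ := 2 * Amax with htR
  have htR0 : 0 ≤ tR := by rw [htR]; positivity
  set tD : ℝ := θD * a₁ with htD
  have htD0 : 0 ≤ tD := mul_nonneg hθD ha₁.le
  set tH : ℝ → ℝ := fun β => θH β * a₁ with htH
  have htH0 : ∀ β, 0 ≤ β → β < 1 → 0 ≤ tH β := fun β h0 h1 => mul_nonneg (hθH β h0 h1) ha₁.le
  set tI : ℝ → ℝ := fun ε => 2 * AI ε with htI
  have htI0 : ∀ ε, 0 < ε → 0 ≤ tI ε := fun ε hε => mul_nonneg zero_le_two (hAI ε hε)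
  set tV : ℝ → ℝ := fun ε => 2 * AV ε with htV
  have htV0 : ∀ ε, 0 < ε → 0 ≤ tV ε := fun ε hε => mul_nonneg zero_le_two (hAV ε hε)
  -- the target constants (the displayed polynomials of `GG_blocks_of_stateS` at the uniform inputs)
  have hCea0 : 0 ≤ const313 (κu * CR * tR * c) (κu * CR * tR * c) B₃ c := const313_nonneg (by positivity) (by positivity) hB₃ hc
  have hCeb0 : 0 ≤ B₀ + κu * tD * tR * c + κu * B₃ * B₃ * c + κu * tD * tR * c * B₃ * c +
      (B₃ + κu * tD * tR * c) * (B₃ * (B₃ * (κu * CR * tR * c) * c) * c) * c := by positivity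
  have hCec0 : 0 ≤ κu * CR₁ * tR * c + κu * B₃ * B₃ * c + κu * CR₁ * tR * c * (B₃ * (B₃ * (κu * CR₁ * tR * c) * c) * c) * c := by positivity
  set Ce : ℝ := const313 (κu * CR * tR * c) (κu * CR * tR * c) B₃ c +
      (B₀ + κu * tD * tR * c + κu * B₃ * B₃ * c + κu * tD * tR * c * B₃ * c +
        (B₃ + κu * tD * tR * c) * (B₃ * (B₃ * (κu * CR * tR * c) * c) * c) * c) +
      (κu * CR₁ * tR * c + κu * B₃ * B₃ * c + κu * CR₁ * tR * c * (B₃ * (B₃ * (κu * CR₁ * tR * c) * c) * c) * c) with hCe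
  have hCe0 : 0 ≤ Ce := add_nonneg (add_nonneg hCea0 hCeb0) hCec0
  set KpU : ℝ := (B₂ + B₄) + (B₂ + B₄) * (θ₂ * a₁ * (2 * (B₂ + B₄)) * c) * c with hKpU
  have hS0 : 0 ≤ B₂ + B₄ := add_nonneg hB₂ hB₄
  have hKpU0 : 0 ≤ KpU :=
    add_nonneg hS0 (mul_nonneg (mul_nonneg hS0 (mul_nonneg (mul_nonneg (mul_nonneg hθ₂ ha₁.le) (by linarith)) hc)) hc)
  set KGu : ℝ := constG46 KpU c with hKGu
  have hKGu0 : 0 ≤ KGu := constG46_nonneg hKpU0 hc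
  set K6 : ℝ := (Ce + KGu + NP * KGu) * Λu with hK6
  set ρ₄ : ℝ := (1 - α) * ρ' - 3 * σ with hρ₄def
  have hρ₄pos : 0 < ρ₄ := by rw [hρ₄def]; linarith
  have hρ₄r : ρ₄ + 3 * σ ≤ (1 - α) * ρ' := by rw [hρ₄def]; linarith
  have hρ₄1 : ρ₄ ≤ (1 - α) * ρ' := by linarith
  have hρ₄2 : ρ₄ ≤ ρ' := by
    have h1 : (1 - α) * ρ' = ρ' - α * ρ' := by ring
    rw [hρ₄def, h1]; linarith [mul_nonneg hα0 hρ'.le]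
  have hm00 : (0 : ℝ) ≤ m := Nat.cast_nonneg m
  have hmN0 : (0 : ℝ) ≤ mN := Nat.cast_nonneg mN
  have hCuL0 : ∀ β, 0 ≤ β → β < 1 → 0 ≤ (Bh β + κu * tH β * tR * c) + κu * BhD β * B₃ * c + κu * tH β * tR * c * B₃ * c +
        (Bq β + κu * tH β * tR * c) * (B₃ * (B₃ * (κu * CR * tR * c) * c) * c) * c := by
    intro β h0 h1
    have := hBh β h0 h1; have := htH0 β h0 h1; have := hBhD β h0 h1; have := hBq β h0 h1
    positivity
  have hCuR0 : ∀ β, 0 ≤ β → β < 1 →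
      0 ≤ (Bh β + κu * tH β * tR * c) + κu * Bx β * B₃ * c + (Bx β + κu * tH β * tR * c) * (B₃ * (B₃ * (κu * CR₁ * tR * c) * c) * c) * c := by
    intro β h0 h1
    have := hBh β h0 h1; have := htH0 β h0 h1; have := hBx β h0 h1
    positivity
  set Cu : ℝ → ℝ := fun β => max (((Bh β + κu * tH β * tR * c) + κu * BhD β * B₃ * c + κu * tH β * tR * c * B₃ * c +
        (Bq β + κu * tH β * tR * c) * (B₃ * (B₃ * (κu * CR * tR * c) * c) * c) * c) +
      ((Bh β + κu * tH β * tR * c) + κu * Bx β * B₃ * c + (Bx β + κu * tH β * tR * c) * (B₃ * (B₃ * (κu * CR₁ * tR * c) * c) * c) * c)) 0 with hCu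
  have hCu0 : ∀ β, 0 ≤ β → β < 1 → 0 ≤ Cu β := fun β _ _ => le_max_right _ _
  have hCuL' : ∀ β, 0 ≤ β → β < 1 → (Bh β + κu * tH β * tR * c) + κu * BhD β * B₃ * c + κu * tH β * tR * c * B₃ * c +
      (Bq β + κu * tH β * tR * c) * (B₃ * (B₃ * (κu * CR * tR * c) * c) * c) * c ≤ Cu β := fun β h0 h1 =>
    (le_add_of_nonneg_right (hCuR0 β h0 h1)).trans (le_max_left _ _)
  have hCuR' : ∀ β, 0 ≤ β → β < 1 → (Bh β + κu * tH β * tR * c) + κu * Bx β * B₃ * c +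
      (Bx β + κu * tH β * tR * c) * (B₃ * (B₃ * (κu * CR₁ * tR * c) * c) * c) * c ≤ Cu β := fun β h0 h1 =>
    (le_add_of_nonneg_left (hCuL0 β h0 h1)).trans (le_max_left _ _)
  set K44 : ℝ → ℝ := fun ε => max ((Bi ε + κu * tD * tI ε * c) + κu * (Bd ε + κu * tD * tV ε * c) * Br ε * c +
      (B₃ + κu * tD * tR * c) * Lc ^ |(1 : ℝ)| * (B₃ * (B₃ * (κu * CR₁ * tI ε * c) * c) * c) * c) 0 with hK44
  have hK440 : ∀ ε, 0 < ε → ε ≤ 1 → 0 ≤ K44 ε := fun ε _ _ => le_max_right _ _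
  set K45 : ℝ → ℝ → ℝ := fun ε β => max ((Bi2 ε β + κu * tH β * tI (β + ε) * c) + κu * (Bd2 ε β + κu * tH β * tV (β + ε) * c) * Br (β + ε) * c +
      (Bq β + κu * tH β * tR * c) * Lc ^ |(1 : ℝ)| * (B₃ * (B₃ * (κu * CR₁ * tI (β + ε) * c) * c) * c) * c) 0 with hK45
  have hK450 : ∀ ε β, 0 < ε → ε ≤ 1 → 0 ≤ β → β < 1 → 0 ≤ K45 ε β := fun ε β _ _ _ _ => le_max_right _ _
  set Bβo : ℝ → ℝ := fun β => max ((m : ℝ) * CL * Real.exp (r * ρ₄) * Cu β) 0 with hBβo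
  set Bεo : ℝ → ℝ := fun ε => max (Real.exp (r * ρ₄) * K44 ε) 0 with hBεo
  set Bεβo : ℝ → ℝ → ℝ := fun ε β => max (CL * Real.exp (r * ρ₄) * K45 ε β) 0 with hBεβo
  have hBβo0 : ∀ β, 0 ≤ Bβo β := fun β => le_max_right _ _
  have hBεo0 : ∀ ε, 0 ≤ Bεo ε := fun ε => le_max_right _ _
  have hBεβo0 : ∀ ε β, 0 ≤ Bεβo ε β := fun ε β => le_max_right _ _
  -- a weighted sharp source is dominated: the a-priori majorant out of `Z_w`
  have hapW : ∀ (i : I) {w : (geo i).Site → ℝ} (hw : ∀ y, 0 < w y) {𝔖 : BlockNorm (toB6 (geo i) (R₀ i) (H₀ i)) (X i → ℝ)} {Λ : ℝ}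
      (_hΛ : 0 ≤ Λ) (_hdom : ∀ (y : (geo i).Site) (F : X i → ℝ), 𝔖.loc y F ≤ Λ * ∑ x : X i, |F x|) (T : (Z i → ℝ) →ₗ[ℝ] (X i → ℝ)),
      ∃ M₀ : ℝ, 0 ≤ M₀ ∧ HasMaj (weightNorm (BlockNorm.ofBlocks (toB6 (geo i) (R₀ i) (H₀ i)) (𝔬 i).blkZ) w fun y => (hw y).le) 𝔖 T
        (fun _ _ => M₀) := by
    intro i w hw 𝔖 Λ hΛ hdom T
    obtain ⟨M₀, hM₀, h⟩ := exists_hasMaj_const_of_dom (hgeo i) (𝔬 i).blkZ (𝔬 i).blk 0 hΛ hdom T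
    set Wi : ℝ := ∑ y : (geo i).Site, (w y)⁻¹ with hWi
    have hWi0 : 0 ≤ Wi := Finset.sum_nonneg fun y _ => (inv_pos.mpr (hw y)).le
    refine ⟨M₀ * Wi, mul_nonneg hM₀ hWi0, ?_⟩
    intro y' μ hμ y
    have hb := h y' μ hμ y
    have e : (cNorm (R₀ i) (H₀ i) (𝔬 i).blkZ (hgeo i).lenle 0).loc y' μ =
        (BlockNorm.ofBlocks (toB6 (geo i) (R₀ i) (H₀ i)) (𝔬 i).blkZ).loc y' μ := by
      simp only [cNorm, weightNorm_loc, wt, pow_zero, inv_one, one_mul]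
    rw [e] at hb
    rw [weightNorm_loc]
    set N : ℝ := (BlockNorm.ofBlocks (toB6 (geo i) (R₀ i) (H₀ i)) (𝔬 i).blkZ).loc y' μ with hN
    have hN0 : 0 ≤ N := BlockNorm.loc_nonneg _ _ _
    have hwy : (w y')⁻¹ ≤ Wi := by
      rw [hWi]
      exact Finset.single_le_sum (f := fun y => (w y)⁻¹) (fun y _ => (inv_pos.mpr (hw y)).le) (Finset.mem_univ y')
    calc 𝔖.loc y (T μ) ≤ M₀ * N := hb
      _ = M₀ * (w y')⁻¹ * (w y' * N) := by rw [mul_assoc, inv_mul_cancel_left₀ (hw y').ne']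
      _ ≤ M₀ * Wi * (w y' * N) :=
          mul_le_mul_of_nonneg_right (mul_le_mul_of_nonneg_left hwy hM₀) (mul_nonneg (hw y').le hN0)
  -- THE PER-MEMBER ASSEMBLY: entries, blocks and the expansion pin, all from the regular state
  have key : ∀ i, M₁' ≤ (geo i).M → ∀ α₀ : ℝ, 0 < α₀ → (geo i).M * α₀ ≤ a₁' →
      ∀ U : (bg i).Cfg, (bg i).Reg335 c35 α₀ U → (bg i).Reg336 c35 α₀ U →
        (HasMajorant (g := toB6 (geo i) (R₀ i) (H₀ i)) (𝔬 i).blk ((𝔬 i).GG U)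
            (fun a b => Ce * (geo i).len a ^ 2 * Real.exp (-(ρ' * (geo i).dist a b))) ∧
          HasMajorantHom (g := toB6 (geo i) (R₀ i) (H₀ i)) (𝔬 i).blk (𝔬 i).blkY ((𝔬 i).D U ∘ₗ (𝔬 i).GG U)
            (fun (a b : (geo i).Site) => Ce * (geo i).len a * Real.exp (-(ρ' * (geo i).dist a b))) ∧
          HasMajorantHom (g := toB6 (geo i) (R₀ i) (H₀ i)) (𝔬 i).blkY (𝔬 i).blk ((𝔬 i).GG U ∘ₗ (𝔬 i).Dstar U)
            (fun (a b : (geo i).Site) => Ce * (geo i).len a * Real.exp (-(ρ' * (geo i).dist a b)))) ∧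
        (∀ (K : B9.KernelFamily (geo i) (bg i)) (δ : ℝ), HasRWExpOfOps (𝔬 i) K U δ) ∧
        (L2Block (GG i) ((mN : ℝ) * m * Cev * CL ^ 2 * Real.exp (r * ρ₄) * K6) ρ₄ U ∧ B9.Ineq343_345 (GG i) Bβo Bεo Bεβo ρ₄ U) := by
    intro i hM α₀ hα₀ hMa U hU hU'
    have hM₁i : M₁ ≤ (geo i).M := hle₁ hM
    have hMpos : 0 < (geo i).M := hM₁.trans_le hM₁i
    have hmα0 : 0 ≤ (geo i).M * α₀ := (mul_pos hMpos hα₀).le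
    have hma₁ : (geo i).M * α₀ ≤ a₁ := hMa.trans ha₁'le
    have hmθ : (geo i).M * α₀ ≤ (2 * (κu * θS * c + 1))⁻¹ := hMa.trans ((min_le_right _ _).trans (min_le_left _ _))
    have hm₂ : (geo i).M * α₀ ≤ (2 * (B₂ * θ₂ * c * c + 1))⁻¹ := hMa.trans ((min_le_right _ _).trans (min_le_right _ _))
    obtain ⟨hF, hI⟩ := hmodel i hM₁i α₀ hα₀ hma₁ U hU hU'
    have he1i := he1 i hM₁i α₀ hα₀ hma₁ U hU hU'
    have z := hZ8 i hM₁i α₀ hα₀ hma₁ U hU hU'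
    have hwGpi := hwGp i hM₁i α₀ hα₀ hma₁ U hU hU'
    have h152i := h152 i hM₁i α₀ hα₀ hma₁ U hU hU'
    obtain ⟨hLD, hLDM⟩ := hlettersD i hM₁i α₀ hα₀ hma₁ U hU hU'
    obtain ⟨hH0, -⟩ := hG0C i hM₁i α₀ hα₀ hma₁ U hU hU'
    have hHH := hLHH i hM₁i α₀ hα₀ hma₁ U hU hU'
    have hH3 := hLH3 i hM₁i α₀ hα₀ hma₁ U hU hU'
    have hL2 := hG0L2 i hM₁i α₀ hα₀ hma₁ U hU hU'
    have hStL := hstepL2 i hM₁i α₀ hα₀ hma₁ U hU hU'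
    obtain ⟨hLt, hLM⟩ := hLL2 i hM₁i α₀ hα₀ hma₁ U hU hU'
    have hrgddi := hrgdd i hM₁i α₀ hα₀ hma₁ U hU hU'
    have hdgDvdi := hdgDvd i hM₁i α₀ hα₀ hma₁ U hU hU'
    have hpdgDvdi := hpdgDvd i hM₁i α₀ hα₀ hma₁ U hU hU'
    obtain ⟨hsymi, htri⟩ := hsymGG i hM₁i α₀ hα₀ hma₁ U hU hU'
    obtain ⟨hS2, hD2, hDd2, hY2, hXd2, hPG0, hPDv2, hPQ2, hRd2, Λ₂, hΛ₂, hdom2⟩ := hstate2 i hM₁i α₀ hα₀ hma₁ U hU hU'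
    obtain ⟨hS1, hDd1, hX1, hXd1, hPDs, hPDds, hPDv1, hPQ1, hRd1, Λ₁, hΛ₁, hdom1⟩ := hstate1 i hM₁i α₀ hα₀ hma₁ U hU hU'
    have hrowi := hrow i (hleL hM)
    obtain ⟨h260, -, hsize⟩ := hLg i (hleg hM)
    obtain ⟨hl0, hl1, hl2, hl3, hl4, hl5⟩ := hl2N i U
    have hH1 := hH1N i U
    have hIn := hIF i U
    have hlen := (hgeo i).lenle
    have hRd₂ : ∀ a b b' : (geo i).Site, Rel i b b' → (geo i).dist a b = (geo i).dist a b' := fun a b b' h => by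
      rw [(hgeo i).symm a b, (hgeo i).symm a b', hRdist i b b' a h]
    -- the small factors of this member
    set θ : ℝ := θS * ((geo i).M * α₀) with hθdef
    set θ' : ℝ := θD * ((geo i).M * α₀) with hθ'def
    set θH' : ℝ → ℝ := fun β => θH β * ((geo i).M * α₀) with hθH'def
    set θ₂' : ℝ := θ₂ * ((geo i).M * α₀) with hθ₂'def
    have hθ : 0 ≤ θ := mul_nonneg hθS hmα0
    have hθ' : 0 ≤ θ' := mul_nonneg hθD hmα0
    have hθH' : ∀ β, 0 ≤ β → β < 1 → 0 ≤ θH' β := fun β h0 h1 => mul_nonneg (hθH β h0 h1) hmα0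
    have hθ₂' : 0 ≤ θ₂' := mul_nonneg hθ₂ hmα0
    have hθ'le : θ' ≤ tD := mul_le_mul_of_nonneg_left hma₁ hθD
    have hθH'le : ∀ β, 0 ≤ β → β < 1 → θH' β ≤ tH β := fun β h0 h1 => mul_le_mul_of_nonneg_left hma₁ (hθH β h0 h1)
    have hθ₂'le : θ₂' ≤ θ₂ * a₁ := mul_le_mul_of_nonneg_left hma₁ hθ₂
    -- κθc ≦ ½ on both states, B₂θ₂c² ≦ ½
    have hκ2i : (𝔖₂ i U).κ ≤ κu := (hκ2 i U).trans hκSu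
    have hκ1i : (𝔖₁ i U).κ ≤ κu := (hκ1 i U).trans hκSu
    have hqS : κu * θ * c ≤ 1 / 2 := by
      have h := small_aux_s hκθc hmθ
      calc κu * θ * c = κu * θS * c * ((geo i).M * α₀) := by rw [hθdef]; ring
        _ ≤ 1 / 2 := h
    have hq2 : (𝔖₂ i U).κ * θ * c ≤ 1 / 2 := (mul_le_mul_of_nonneg_right (mul_le_mul_of_nonneg_right hκ2i hθ) hc).trans hqS
    have hq1 : (𝔖₁ i U).κ * θ * c ≤ 1 / 2 := (mul_le_mul_of_nonneg_right (mul_le_mul_of_nonneg_right hκ1i hθ) hc).trans hqS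
    have hq2lt : (𝔖₂ i U).κ * θ * c < 1 := lt_one_of_le_half hq2
    have hq1lt : (𝔖₁ i U).κ * θ * c < 1 := lt_one_of_le_half hq1
    have hinv2 : (1 - (𝔖₂ i U).κ * θ * c)⁻¹ ≤ 2 := inv_one_sub_le_two hq2
    have hinv1 : (1 - (𝔖₁ i U).κ * θ * c)⁻¹ ≤ 2 := inv_one_sub_le_two hq1
    have hinv20 : 0 ≤ (1 - (𝔖₂ i U).κ * θ * c)⁻¹ := inv_nonneg.mpr (sub_nonneg.mpr hq2lt.le)
    have hinv10 : 0 ≤ (1 - (𝔖₁ i U).κ * θ * c)⁻¹ := inv_nonneg.mpr (sub_nonneg.mpr hq1lt.le)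
    have hq₂ : B₂ * θ₂' * c * c ≤ 1 / 2 := by
      have h := small_aux_s hB₂c hm₂
      calc B₂ * θ₂' * c * c = B₂ * θ₂ * c * c * ((geo i).M * α₀) := by rw [hθ₂'def]; ring
        _ ≤ 1 / 2 := h
    have hq₂1 : B₂ * θ₂' * c * c < 1 := lt_one_of_le_half hq₂
    -- rates: the right entries at ρ₁ = ρ + σ
    have hρ0 : 0 ≤ ρ := by linarith
    have hρ₁0 : 0 ≤ ρ + σ := add_nonneg hρ0 hσ
    have hρ₁P : ρ + σ ≤ δP := by linarith
    have hρ₁K : ρ + σ + σ ≤ δK := by linarith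
    have hσK : σ ≤ δK := by linarith
    have hσP : σ ≤ δP := by linarith
    have hρK2 : ρ + 2 * σ ≤ δK := hρδ
    have hfix1 := fix_of_inverses hI.invG0' hI.invG1
    -- the kernel weakening helper
    have wk : ∀ {F₁ F₂ : Type} [AddCommGroup F₁] [Module ℝ F₁] [AddCommGroup F₂] [Module ℝ F₂]
        {b₁ : BlockNorm (toB6 (geo i) (R₀ i) (H₀ i)) F₁} {b₂ : BlockNorm (toB6 (geo i) (R₀ i) (H₀ i)) F₂} {T : F₁ →ₗ[ℝ] F₂} {C C' r₁ : ℝ},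
        C ≤ C' → HasMaj b₁ b₂ T (fun a b => C * Real.exp (-(r₁ * (geo i).dist a b))) →
          HasMaj b₁ b₂ T (fun a b => C' * Real.exp (-(r₁ * (geo i).dist a b))) :=
      fun hCC h => h.mono fun a b => mul_le_mul_of_nonneg_right hCC (Real.exp_nonneg _)
    -- uniform bounds for the produced constants: A·(1−κθc)⁻¹ ≤ 2A ≤ t
    have hu2 : ∀ {A : ℝ}, 0 ≤ A → A ≤ Amax → A * (1 - (𝔖₂ i U).κ * θ * c)⁻¹ ≤ tR := fun {A} hA hAle => by
      calc _ ≤ A * 2 := mul_le_mul_of_nonneg_left hinv2 hA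
        _ ≤ Amax * 2 := mul_le_mul_of_nonneg_right hAle zero_le_two
        _ = tR := by rw [htR]; ring
    have hu1 : ∀ {A : ℝ}, 0 ≤ A → A ≤ Amax → A * (1 - (𝔖₁ i U).κ * θ * c)⁻¹ ≤ tR := fun {A} hA hAle => by
      calc _ ≤ A * 2 := mul_le_mul_of_nonneg_left hinv1 hA
        _ ≤ Amax * 2 := mul_le_mul_of_nonneg_right hAle zero_le_two
        _ = tR := by rw [htR]; ring
    have hA₀le : A₀ ≤ Amax := by rw [hAmax]; linarith
    have hAWle : AW ≤ Amax := by rw [hAmax]; linarith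
    have hAQle : AQ ≤ Amax := by rw [hAmax]; linarith
    have hADle : AD ≤ Amax := by rw [hAmax]; linarith
    have hAQ1le : AQ1 ≤ Amax := by rw [hAmax]; linarith
    -- THE RIGHT ENTRIES OF G₁ INTO THE STATES (`hasMaj_right_of_stepS` with an a-priori majorant)
    have hG12 : HasMaj (cNorm (R₀ i) (H₀ i) (𝔬 i).blk (hgeo i).lenle 0) (𝔖₂ i U) ((𝔬 i).G1 U ∘ₗ LinearMap.id)
        (fun a b => tR * Real.exp (-((ρ + σ) * (geo i).dist a b))) := by
      obtain ⟨M₀, hM₀, hap⟩ := exists_hasMaj_const_of_dom (hgeo i) (𝔬 i).blk (𝔬 i).blk 0 hΛ₂ hdom2 ((𝔬 i).G1 U ∘ₗ LinearMap.id)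
      have hS : HasMaj (cNorm (R₀ i) (H₀ i) (𝔬 i).blk (hgeo i).lenle 0) (𝔖₂ i U) ((𝔬 i).G0 U ∘ₗ LinearMap.id)
          (fun a b => A₀ * Real.exp (-(δP * (geo i).dist a b))) := by rw [LinearMap.comp_id]; exact hPG0
      exact wk (hu2 hA₀ hA₀le) (hasMaj_right_of_stepS (hgeo i) hrowi hθ hA₀ hM₀ hρ₁0 hρ₁P hρ₁K hS2.step1 hS hfix1 hap hq2lt)
    have hGD2 : HasMaj (cNorm (R₀ i) (H₀ i) (𝔬 i).blkW (hgeo i).lenle 1) (𝔖₂ i U) ((𝔬 i).G1 U ∘ₗ (𝔬 i).Dv U)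
        (fun a b => tR * Real.exp (-((ρ + σ) * (geo i).dist a b))) := by
      obtain ⟨M₀, hM₀, hap⟩ := exists_hasMaj_const_of_dom (hgeo i) (𝔬 i).blkW (𝔬 i).blk 1 hΛ₂ hdom2 ((𝔬 i).G1 U ∘ₗ (𝔬 i).Dv U)
      exact wk (hu2 hAW hAWle) (hasMaj_right_of_stepS (hgeo i) hrowi hθ hAW hM₀ hρ₁0 hρ₁P hρ₁K hS2.step1 hPDv2 hfix1 hap hq2lt)
    have hGQ2 : HasMaj (weightNorm (BlockNorm.ofBlocks (toB6 (geo i) (R₀ i) (H₀ i)) (𝔬 i).blkZ) (wZ i) fun y => (hwZ i y).le) (𝔖₂ i U)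
        ((𝔬 i).G1 U ∘ₗ (𝔬 i).Qstar U) (fun a b => tR * Real.exp (-((ρ + σ) * (geo i).dist a b))) := by
      obtain ⟨M₀, hM₀, hap⟩ := hapW i (hwZ i) hΛ₂ hdom2 ((𝔬 i).G1 U ∘ₗ (𝔬 i).Qstar U)
      exact wk (hu2 hAQ hAQle) (hasMaj_right_of_stepS (hgeo i) hrowi hθ hAQ hM₀ hρ₁0 hρ₁P hρ₁K hS2.step1 hPQ2 hfix1 hap hq2lt)
    have hGDs1 : HasMaj (cNormR (R₀ i) (H₀ i) (𝔬 i).blkY (hgeo i).lenle 0) (𝔖₁ i U) ((𝔬 i).G1 U ∘ₗ (𝔬 i).Dstar U)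
        (fun a b => tR * Real.exp (-((ρ + σ) * (geo i).dist a b))) := by
      obtain ⟨M₀, hM₀, hap⟩ := exists_hasMaj_const_of_dom (hgeo i) (𝔬 i).blkY (𝔬 i).blk 0 hΛ₁ hdom1 ((𝔬 i).G1 U ∘ₗ (𝔬 i).Dstar U)
      have hap' : HasMaj (cNormR (R₀ i) (H₀ i) (𝔬 i).blkY (hgeo i).lenle 0) (𝔖₁ i U) ((𝔬 i).G1 U ∘ₗ (𝔬 i).Dstar U) (fun _ _ => M₀) := by
        have h := hasMaj_toR_src (hgeo i) hap
        rwa [Nat.cast_zero, neg_zero] at h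
      exact wk (hu1 hAD hADle) (hasMaj_right_of_stepS (hgeo i) hrowi hθ hAD hM₀ hρ₁0 hρ₁P hρ₁K hS1.step1 hPDs hfix1 hap' hq1lt)
    have hGQ1 : HasMaj (weightNorm (BlockNorm.ofBlocks (toB6 (geo i) (R₀ i) (H₀ i)) (𝔬 i).blkZ) (fun y => (geo i).len y * wZ i y)
        fun y => (wZlen_pos (hgeo i) (hwZ i) y).le) (𝔖₁ i U) ((𝔬 i).G1 U ∘ₗ (𝔬 i).Qstar U)
        (fun a b => tR * Real.exp (-((ρ + σ) * (geo i).dist a b))) := by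
      obtain ⟨M₀, hM₀, hap⟩ := hapW i (wZlen_pos (hgeo i) (hwZ i)) hΛ₁ hdom1 ((𝔬 i).G1 U ∘ₗ (𝔬 i).Qstar U)
      exact wk (hu1 hAQ1 hAQ1le) (hasMaj_right_of_stepS (hgeo i) hrowi hθ hAQ1 hM₀ hρ₁0 hρ₁P hρ₁K hS1.step1 hPQ1 hfix1 hap hq1lt)
    have hGI1 : ∀ (μ : P) (ε : ℝ), 0 < ε → HasMaj (bHX i ε) (𝔖₁ i U) ((𝔬 i).G1 U ∘ₗ Dds i U μ)
        (fun a b => tI ε * Real.exp (-((ρ + σ) * (geo i).dist a b))) := by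
      intro μ ε hε
      obtain ⟨ΛX, hΛX, hl1X⟩ := hdomX i ε hε
      obtain ⟨M₀, hM₀, hap⟩ := B9StateAprioriL1.exists_hasMaj_const_of_l1_src hΛX hl1X hΛ₁ hdom1 ((𝔬 i).G1 U ∘ₗ Dds i U μ)
      have h := hasMaj_right_of_stepS (hgeo i) hrowi hθ (hAI ε hε) hM₀ hρ₁0 hρ₁P hρ₁K hS1.step1 (hPDds μ ε hε) hfix1 hap hq1lt
      exact wk (by calc _ ≤ AI ε * 2 := mul_le_mul_of_nonneg_left hinv1 (hAI ε hε)
                    _ = tI ε := by rw [htI]; ring) h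
    have hGV1 : ∀ ε : ℝ, 0 < ε → HasMaj (bHW i U ε) (𝔖₁ i U) ((𝔬 i).G1 U ∘ₗ (𝔬 i).Dv U)
        (fun a b => tV ε * Real.exp (-((ρ + σ) * (geo i).dist a b))) := by
      intro ε hε
      classical
      obtain ⟨ΛW, hΛW, hl1W⟩ := hdomW i U ε hε
      obtain ⟨M₀, hM₀, hap⟩ := B9StateAprioriL1.exists_hasMaj_const_of_l1_src hΛW hl1W hΛ₁ hdom1 ((𝔬 i).G1 U ∘ₗ (𝔬 i).Dv U)
      have h := hasMaj_right_of_stepS (hgeo i) hrowi hθ (hAV ε hε) hM₀ hρ₁0 hρ₁P hρ₁K hS1.step1 (hPDv1 ε hε) hfix1 hap hq1lt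
      exact wk (by calc _ ≤ AV ε * 2 := mul_le_mul_of_nonneg_left hinv1 (hAV ε hε)
                    _ = tV ε := by rw [htV]; ring) h
    -- G₁∇\*_U INTO bXH = 𝔖₁, DERIVED from the state (no raw-class step, no displayed `gXH`): `gXH_of_stateS_two` at rate ρ, constant 2·A_D ≤ B₃
    have hgXH : HasMaj (cNorm (R₀ i) (H₀ i) (𝔬 i).blkY (hgeo i).lenle 0) (bXH i U) ((𝔬 i).G1 U ∘ₗ (𝔬 i).Dstar U)
        (fun a b => B₃ * Real.exp (-(ρ * (geo i).dist a b))) := by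
      have hρP1 : ρ ≤ δP := by linarith
      have hρK1 : ρ + σ ≤ δK := by linarith
      have h := gXH_of_stateS_two (hgeo i) hrowi hθ hAD hρ0 hρP1 hρK1 hS1 hPDs hI hΛ₁ hdom1 hq1
      rw [hSX i U] at h
      exact h.mono (kernel_mono (hgeo i) (by positivity) hADB le_rfl)
    -- every δ₃-rate letter weakened to the master rate ρ (ρ ≤ δ₃), the record `Letters313Zc` REBUILT at (B₃, ρ) with the derived `gXH`
    have kB := fun (a b : (geo i).Site) => kernel_mono (hgeo i) hB₃ (le_refl B₃) hρ₃ a b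
    have hL : Letters313Zc (𝔬 i) (Gp i) (R₀ i) (H₀ i) (hgeo i) (wZ i) (hwZ i) B₃ ρ (bXH i U) U :=
      ⟨z.1.mono kB, z.2.1.mono kB, z.2.2.1.mono kB, z.2.2.2.1.mono kB, z.2.2.2.2.1.mono kB, z.2.2.2.2.2.1.mono kB,
        z.2.2.2.2.2.2.1.mono kB, z.2.2.2.2.2.2.2.mono kB, hgXH, hwGpi.mono kB⟩
    have hHHρ : LettersHHZ (𝔬 i) (𝔭 i) (R₀ i) (H₀ i) (hgeo i).lenle
        (weightNorm (BlockNorm.ofBlocks (toB6 (geo i) (R₀ i) (H₀ i)) (𝔬 i).blkZ) (wZ i) fun y => (hwZ i y).le) Bq ρ U :=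
      lettersHHZ_mono (hgeo i) hBq (fun β _ _ => le_refl (Bq β)) hρ₃ hHH
    have hH3ρ : Letters313HZc (𝔬 i) (𝔭 i) (Gp i) (R₀ i) (H₀ i) (hgeo i) (wZ i) (hwZ i) (bH i U) BhD Bx ρ (bXH i U) U :=
      ⟨fun β h0 h1 => (hH3.pYDH β h0 h1).mono (kernel_mono (hgeo i) (hBhD β h0 h1) le_rfl hρ₃),
        fun β h0 h1 => (hH3.pXQs β h0 h1).mono (kernel_mono (hgeo i) (hBx β h0 h1) le_rfl hρ₃),
        fun β h0 h1 => (hH3.pWE β h0 h1).mono (kernel_mono (hgeo i) (hBx β h0 h1) le_rfl hρ₃)⟩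
    have hLDρ : Letters313DZ (𝔬 i) (R₀ i) (H₀ i) (hgeo i) (wZ i) (hwZ i) B₃ ρ (bH i U) U := letters313DZ_mono (hgeo i) hB₃ le_rfl hρ₃ hLD
    have hLDMρ : Letters313DMZ (𝔬 i) (𝔭 i) (Dd i) (R₀ i) (H₀ i) (hgeo i) (wZ i) (hwZ i) B₃ Bq ρ (bH i U) U :=
      letters313DMZ_mono (hgeo i) hB₃ le_rfl hBq (fun β _ _ => le_refl (Bq β)) hρ₃ hLDM
    have hrgddρ : ∀ (μ : P) (ε : ℝ), 0 < ε → HasMaj (bHX i ε) (bHW i U ε) ((𝔬 i).R U ∘ₗ (𝔬 i).Dvstar U ∘ₗ (𝔬 i).G1 U ∘ₗ Dds i U μ)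
        (fun a b => Br ε * Real.exp (-(ρ * (geo i).dist a b))) :=
      fun μ ε hε => (hrgddi μ ε hε).mono (kernel_mono (hgeo i) (hBr ε hε) le_rfl hρ₃)
    have hdgDvdρ : ∀ (ν : P) (ε : ℝ), 0 < ε → ε ≤ 1 → HasMaj (bHW i U ε) (BlockNorm.ofBlocks (toB6 (geo i) (R₀ i) (H₀ i)) (𝔬 i).blk)
        (Dd i U ν ∘ₗ ((𝔬 i).G0 U ∘ₗ (𝔬 i).Dv U)) (fun (a b : (geo i).Site) => Bd ε * Real.exp (-(ρ * (geo i).dist a b))) :=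
      fun ν ε h0 h1 => (hdgDvdi ν ε h0 h1).mono (kernel_mono (hgeo i) (hBd ε h0 h1) le_rfl hρ₃)
    have hpdgDvdρ : ∀ (ν : P) (ε β : ℝ), 0 < ε → ε ≤ 1 → 0 ≤ β → β < 1 →
        HasMaj (bHW i U (β + ε)) (BlockNorm.ofBlocks (toB6 (geo i) (R₀ i) (H₀ i)) (𝔭 i).blkPX)
          (((𝔭 i).ΦX U β ∘ₗ Dd i U ν) ∘ₗ ((𝔬 i).G0 U ∘ₗ (𝔬 i).Dv U))
          (fun (a b : (geo i).Site) => Bd2 ε β * (geo i).len a ^ (-β) * Real.exp (-(ρ * (geo i).dist a b))) :=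
      fun ν ε β h0 h1 hb0 hb1 => (hpdgDvdi ν ε β h0 h1 hb0 hb1).mono fun a b =>
        mul_le_mul_of_nonneg_left
          (Real.exp_le_exp.mpr (neg_le_neg (mul_le_mul_of_nonneg_right hρ₃ ((hgeo i).dnn a b))))
          (mul_nonneg (hBd2 ε β h0 h1 hb0 hb1) (Real.rpow_nonneg ((hgeo i).lenle a) _))
    -- the step fields at the uniform constants
    have hD2u := wk hθ'le hD2
    have hDd2u := fun ν => wk hθ'le (hDd2 ν)
    have hY2u := fun β (h0 : 0 ≤ β) (h1 : β < 1) => wk (hθH'le β h0 h1) (hY2 β h0 h1)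
    have hXd2u := fun ν β (h0 : 0 ≤ β) (h1 : β < 1) => wk (hθH'le β h0 h1) (hXd2 ν β h0 h1)
    have hDd1u := fun ν => wk hθ'le (hDd1 ν)
    have hX1u := fun β (h0 : 0 ≤ β) (h1 : β < 1) => wk (hθH'le β h0 h1) (hX1 β h0 h1)
    have hXd1u := fun ν β (h0 : 0 ≤ β) (h1 : β < 1) => wk (hθH'le β h0 h1) (hXd1 ν β h0 h1)
    -- the L²-class constants below KGu and K₆; the scale transfers
    have hKp0 : 0 ≤ constKp B₂ B₄ θ₂' c := (constP_nonneg_le hθ₂' hc hq₂1 hS0 hS0 hS0 le_rfl le_rfl le_rfl).1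
    have hKGle : constG46 (constKp B₂ B₄ θ₂' c) c ≤ KGu := constG46_mono hKp0 (constKp_le hB₂ hB₄ hθ₂' hθ₂'le hc hq₂) hc
    have hL0i : 0 < (geo i).L := lt_of_lt_of_le one_pos (hL1 i)
    have hL4 : (geo i).L ^ (4 : ℝ) ≤ Λu := Real.rpow_le_rpow hL0i.le (hLle i) (by norm_num)
    have h1Λu : 1 ≤ Λu := by rw [hΛu]; exact Real.one_le_rpow (hLc1 i) (by norm_num)
    have hΛu0 : 0 ≤ Λu := zero_le_one.trans h1Λu
    have hK60 : 0 ≤ K6 := mul_nonneg (add_nonneg (add_nonneg hCe0 hKGu0) (mul_nonneg hNP0 hKGu0)) hΛu0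
    have hK6a : Ce * Λu ≤ K6 := by
      have h0 : 0 ≤ (KGu + NP * KGu) * Λu := mul_nonneg (add_nonneg hKGu0 (mul_nonneg hNP0 hKGu0)) hΛu0
      calc Ce * Λu ≤ Ce * Λu + (KGu + NP * KGu) * Λu := le_add_of_nonneg_right h0
        _ = K6 := by rw [hK6]; ring
    have hK6c : NP * (KGu * Λu) ≤ K6 := by
      have h0 : 0 ≤ (Ce + KGu) * Λu := mul_nonneg (add_nonneg hCe0 hKGu0) hΛu0
      calc NP * (KGu * Λu) ≤ NP * (KGu * Λu) + (Ce + KGu) * Λu := le_add_of_nonneg_right h0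
        _ = K6 := by rw [hK6]; ring
    have hK6b : KGu ≤ K6 := by
      have h1 : KGu ≤ KGu * Λu := le_mul_of_one_le_right hKGu0 h1Λu
      have h0 : 0 ≤ (Ce + NP * KGu) * Λu := mul_nonneg (add_nonneg hCe0 (mul_nonneg hNP0 hKGu0)) hΛu0
      have h2 : KGu * Λu ≤ K6 :=
        calc KGu * Λu ≤ KGu * Λu + (Ce + NP * KGu) * Λu := le_add_of_nonneg_right h0
          _ = K6 := by rw [hK6]; ring
      exact h1.trans h2
    have hST : ∀ γ : ℝ, |γ| ≤ 4 → ScaleTransfer (geo i) ρ' α ((geo i).L ^ |γ|) (fun y => (geo i).len y ^ γ) ∧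
        0 ≤ (geo i).L ^ |γ| ∧ (geo i).L ^ |γ| ≤ Λu := fun γ hγ =>
      ⟨scaleTransfer_rpow_of_260 h260 hsize (hL1 i) (hη i) γ hγ, Real.rpow_nonneg hL0i.le _,
        (B9Ineq347AllEntries.size_condition_compact (geo i).L γ _ (hL1 i) hγ hsize).2.trans hL4⟩
    obtain ⟨hST1, hΛ₁0, hΛ₁le⟩ := hST 1 (by norm_num)
    obtain ⟨hSTh, -, hΛhle⟩ := hST (1 / 2) (by rw [abs_of_nonneg (by norm_num : (0 : ℝ) ≤ 1 / 2)]; norm_num)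
    obtain ⟨hSTm, hΛm0, hΛmle⟩ := hST (-1) (by norm_num)
    have hΛ₁Lc : (geo i).L ^ |(1 : ℝ)| ≤ Lc ^ |(1 : ℝ)| := Real.rpow_le_rpow hL0i.le (hLle i) (abs_nonneg _)
    -- the L² schemas at the common rate ρ
    have hρKle : ρ ≤ δK := by linarith
    have hexpK : ∀ y y' : (geo i).Site, Real.exp (-(δK * (geo i).dist y y')) ≤ Real.exp (-(ρ * (geo i).dist y y')) := fun y y' =>
      Real.exp_le_exp.mpr (neg_le_neg (mul_le_mul_of_nonneg_right hρKle ((hgeo i).dnn y y')))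
    have hL2ρ : Thm33G0L2M (𝔬 i) (Dd i) (Dds i) (R₀ i) (H₀ i) B₂ ρ U := thm33G0L2M_mono (hgeo i) hB₂ hρS hL2
    have hTρ : BlockBd (g := toB6 (geo i) (R₀ i) (H₀ i)) (𝔬 i).blk (𝔬 i).blk ((𝔬 i).Tpi U + (𝔬 i).T2 U)
        (fun (y y' : (geo i).Site) => θ₂' * ((geo i).len y)⁻¹ * ((geo i).len y')⁻¹ * Real.exp (-(ρ * (geo i).dist y y'))) :=
      hStL.t1.mono fun y y' => mul_le_mul_of_nonneg_left (hexpK y y')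
        (mul_nonneg (mul_nonneg hθ₂' (inv_nonneg.mpr (hlen y))) (inv_nonneg.mpr (hlen y')))
    have hLtρ : Letters313L2Pc (𝔬 i) (Dd i) (Dds i) (R₀ i) (H₀ i) B₄ ρ (vZ i) (hvZ i) U := letters313L2Pc_mono (hgeo i) hB₄ hρ₃ hLt
    have hLMρ : Letters313L2MZ (𝔬 i) (Dd i) (Dds i) (R₀ i) (H₀ i) B₄ ρ (vZ i) (hvZ i) U := letters313L2MZ_mono (hgeo i) hB₄ hρ₃ hLM
    -- the target inequalities of `GG_blocks_of_stateS` at the uniform constants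
    have hκi : (bH i U).κ ≤ κu := (hκ i U).trans hκ0u
    have hκWi : ∀ ε, (bHW i U ε).κ ≤ κu := fun ε => (hκW i U ε).trans hκ0u
    have hκXi : (bXH i U).κ ≤ κu := (hκX i U).trans hκ0u
    have hCea' : const313 (κu * CR * tR * c) (κu * CR * tR * c) B₃ c ≤ Ce := by linarith only [hCeb0, hCec0]
    have hCeb' : B₀ + κu * tD * tR * c + κu * B₃ * B₃ * c + κu * tD * tR * c * B₃ * c +
        (B₃ + κu * tD * tR * c) * (B₃ * (B₃ * (κu * CR * tR * c) * c) * c) * c ≤ Ce := by linarith only [hCea0, hCec0]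
    have hCec' : κu * CR₁ * tR * c + κu * B₃ * B₃ * c + κu * CR₁ * tR * c * (B₃ * (B₃ * (κu * CR₁ * tR * c) * c) * c) * c ≤ Ce := by
      linarith only [hCea0, hCeb0]
    have hK44le : ∀ ε, 0 < ε → ε ≤ 1 → (Bi ε + κu * tD * tI ε * c) + κu * (Bd ε + κu * tD * tV ε * c) * Br ε * c +
        (B₃ + κu * tD * tR * c) * (geo i).L ^ |(1 : ℝ)| * (B₃ * (B₃ * (κu * CR₁ * tI ε * c) * c) * c) * c ≤ K44 ε := by
      intro ε h0 h1
      have := hBi ε h0 h1; have := htI0 ε h0; have := hBd ε h0 h1; have := htV0 ε h0; have := hBr ε h0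
      have e : (B₃ + κu * tD * tR * c) * (geo i).L ^ |(1 : ℝ)| * (B₃ * (B₃ * (κu * CR₁ * tI ε * c) * c) * c) * c ≤
          (B₃ + κu * tD * tR * c) * Lc ^ |(1 : ℝ)| * (B₃ * (B₃ * (κu * CR₁ * tI ε * c) * c) * c) * c := by
        have h2 : 0 ≤ B₃ + κu * tD * tR * c := by positivity
        have h3 : 0 ≤ (B₃ * (B₃ * (κu * CR₁ * tI ε * c) * c) * c) * c := by positivity
        have := mul_le_mul_of_nonneg_right (mul_le_mul_of_nonneg_left hΛ₁Lc h2) h3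
        linarith [this]
      refine le_trans ?_ (le_max_left _ _)
      linarith only [e]
    have hK45le : ∀ ε β, 0 < ε → ε ≤ 1 → 0 ≤ β → β < 1 → (Bi2 ε β + κu * tH β * tI (β + ε) * c) +
        κu * (Bd2 ε β + κu * tH β * tV (β + ε) * c) * Br (β + ε) * c +
        (Bq β + κu * tH β * tR * c) * (geo i).L ^ |(1 : ℝ)| * (B₃ * (B₃ * (κu * CR₁ * tI (β + ε) * c) * c) * c) * c ≤ K45 ε β := by
      intro ε β h0 h1 hb0 hb1
      have hε' : 0 < β + ε := by linarith
      have := hBq β hb0 hb1; have := htH0 β hb0 hb1; have := htI0 (β + ε) hε'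
      have e : (Bq β + κu * tH β * tR * c) * (geo i).L ^ |(1 : ℝ)| * (B₃ * (B₃ * (κu * CR₁ * tI (β + ε) * c) * c) * c) * c ≤
          (Bq β + κu * tH β * tR * c) * Lc ^ |(1 : ℝ)| * (B₃ * (B₃ * (κu * CR₁ * tI (β + ε) * c) * c) * c) * c := by
        have h2 : 0 ≤ Bq β + κu * tH β * tR * c := by positivity
        have h3 : 0 ≤ (B₃ * (B₃ * (κu * CR₁ * tI (β + ε) * c) * c) * c) * c := by positivity
        have := mul_le_mul_of_nonneg_right (mul_le_mul_of_nonneg_left hΛ₁Lc h2) h3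
        linarith [this]
      refine le_trans ?_ (le_max_left _ _)
      linarith only [e]
    -- THE BLOCKS OF 𝔊 FROM THE STATE
    obtain ⟨hent, hl2B, hHo⟩ := GG_blocks_of_stateST (hgeo i) (𝔭 i) (GG i) (𝔖₂ i U) (𝔖₁ i U) (Rel i) (ev i) (evY i) hrowi hc htD0 htR0 htH0
      htI0 htV0 hθ₂' hB₀ hB₂ hB₃ hB₄ hCR hCR₁ h1κ hBr hBh hBi hBq hBd hBi2 hBd2 hBhD hBx hκi hκWi hκXi hκ2i hκ1i hα0 hσ hρ'
      hρ'ρ hρ'ρ₅ hρ₄pos.le hρ₄r hρS le_rfl rfl hρP hρK2 hq₂1 hρ₄pos.le hρ₄1 hρ₄2 hST1 hSTh hSTm hΛ₁0 hΛ₁le hΛhle hΛm0 hΛmle h1Λu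
      hCe0 hCea' hCeb' hCec' hKGu0 hKGle hK60 hK6a hK6b hK6c hCu0 hCuL' hCuR' hK440 hK44le hK450 hK45le he1i hH0 hHHρ hH3ρ hL hLDρ
      hLDMρ hrgddρ hdgDvdρ hpdgDvdρ hI h152i hL2ρ hTρ hLtρ hLMρ hsymi htri hRd₂ (hmult i) (hnbr i) hCL1 (hCL i) hCev hl0 hl1 hl2 hl3 hl4 hl5 hH1 hIn
      hD2u hDd2u hY2u hXd2u hDd1u hX1u hXd1u hG12 hGD2 hGQ2 hGDs1 hGQ1 hGI1 hGV1 hRd2 hRd1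
    -- the expansion pin from the state (`hasRWExp_of_stepS`)
    obtain ⟨MG, hMG, hapG⟩ := exists_hasMaj_const_of_dom (hgeo i) (𝔬 i).blk (𝔬 i).blk 0 hΛ₂ hdom2 ((𝔬 i).G U)
    obtain ⟨MG1, hMG1, hapG1⟩ := exists_hasMaj_const_of_dom (hgeo i) (𝔬 i).blk (𝔬 i).blk 0 hΛ₂ hdom2 ((𝔬 i).G1 U)
    have hRW := hasRWExp_of_stepS (hgeo i) hrowi hθ hσK hσP hMG hMG1 hCR hq2lt hS2 hI hapG hapG1 hRd2
    -- the Hölder block at the uniform families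
    have hβo : ∀ β, 0 ≤ β → β < 1 → (m : ℝ) * CL * Real.exp (r * ρ₄) * Cu β ≤ Bβo β ∧ 0 ≤ Bβo β := fun β _ _ =>
      ⟨le_max_left _ _, hBβo0 β⟩
    have hεo : ∀ ε, 0 < ε → ε ≤ 1 → Real.exp (r * ρ₄) * K44 ε ≤ Bεo ε ∧ 0 ≤ Bεo ε := fun ε _ _ => ⟨le_max_left _ _, hBεo0 ε⟩
    have hεβo : ∀ ε β, 0 < ε → ε ≤ 1 → 0 ≤ β → β < 1 → CL * Real.exp (r * ρ₄) * K45 ε β ≤ Bεβo ε β ∧ 0 ≤ Bεβo ε β :=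
      fun ε β _ _ _ _ => ⟨le_max_left _ _, hBεβo0 ε β⟩
    exact ⟨hent, hRW, hl2B, ineq343_345_mono_on (S i) hHo (hgeo i).lenpos hβo hεo hεβo le_rfl⟩
  -- the frame cut at the 𝔊-entry line
  exact thm313Printed_of_entriesRelZcU 𝔬 R₀ H₀ GG ev evY Rel m r₁ Ce a₁' M₁' ((mN : ℝ) * m * Cev * CL ^ 2 * Real.exp (r * ρ₄) * K6) ρ₄ ρ' α Lc
    Bβo Bεo Bεβo hr₁ hCe0 hρ' ha₁'pos hM₁'pos hρ₄pos hBβo0 hBεo0 hBεβo0 hgeo S hL1 hLle hη hL21 hsat hmult hcoR hco1R hcoG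
    (fun i hM α₀ hα₀ hMa U hU hU' => hmodel i (hle₁ hM) α₀ hα₀ (hMa.trans ha₁'le) U hU hU')
    (fun i hM α₀ hα₀ hMa U hU hU' => (key i hM α₀ hα₀ hMa U hU hU').1)
    (fun i hM α₀ hα₀ hMa U hU hU' => (key i hM α₀ hα₀ hMa U hU hU').2.1)
    (fun i hM α₀ hα₀ hMa U hU hU' => (key i hM α₀ hα₀ hMa U hU hU').2.2)

end Family

end

end Literature.MathematicalPhysics.QuantumFieldTheory.Balaban1983to89.B9Thm313WholeLeafCompletePairMBCZcUSX
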